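import Literature.NumberTheory.Sieve.IwaniecBilinearSieveBuchstab
import Literature.NumberTheory.Sieve.BombieriFriedlanderIwaniec
import HarnessLib

/-!
# Iwaniec's bilinear linear sieve, XI: the remainder with WELL-FACTORABLE weights

Topic `Literature/NumberTheory/Sieve`; eleventh support file of the Iwaniec-1980b development
(`IwaniecBilinearSieve{Composite,Boxes,Bilinear,Strips,Levels,MainTerms,Assembly,Regime,Buchstab}.lean`,
H. Iwaniec, *A new form of the error term in the linear sieve*, Acta Arith. 37 (1980), 307–320
[IwaniecActaArith1980b]).  Bombieri–Friedlander–Iwaniec (Acta Math. 156 (1986), §1, Definition before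
Theorem 10) call `λ` WELL FACTORABLE of level `Q` if for every `Q = Q₁ Q₂`, `Q₁, Q₂ ≥ 1`, `λ = λ₁ ⋆ λ₂` with
`|λᵢ| ≤ 1`, `λᵢ` of level `Qᵢ` (the tree's `Literature.NumberTheory.Sieve.IsWellFactorable`), and use
(Corollary 2, p. 209; §17, p. 251: "Corollary 2 is an immediate consequence of Theorem 10 and of the linear
sieve result of [15]") that the remainder of Iwaniec's linear sieve is a bounded number of sums
`∑_q λ_l(q) r(𝒜, q)` with `λ_l` well factorable.  This file PROVES that form for the weights `Λ⁺_z` of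
`IwaniecBilinearSieveAssembly.lean` (`Core.LamZ`).

Design (the one subtle point).  The bilinear coefficients of `IwaniecBilinearSieveBilinear.lean` (pattern
INDICATORS divided by binomial counts) reproduce `Λ_z` on the squarefree support but are not well factorable
in the strict sense of `IsWellFactorable` (equality `λ = α ⋆ β` at EVERY `q`, squarefree or not): already the
indicator of products of two distinct primes of one box does not factor exactly at the split `(1, 1)`.  We
therefore replace, box by box, the indicator of "`r` distinct primes of box `j`" by the normalised
convolution power `(r!)⁻¹ E_j^{⋆ r}` of the indicator `E_j` of the primes of the box (`WF.Tpow`); the two agree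
on squarefree numbers, and the powers factor EXACTLY: `(a! b!)⁻¹ E^{⋆a} ⋆ E^{⋆b} = C(a+b, a) ((a+b)!)⁻¹ E^{⋆(a+b)}`.
The resulting weights `WF.wfLam k` (one for each pattern `k` of the finite universe `Core.Univ`) satisfy:
`|wfLam k| ≤ 1` (`WF.abs_wfLam_le_one`); `wfLam k` is well factorable of level `Q = D^{1+η+2ε}`
(`WF.isWellFactorable_wfLam`, by Lemma 1 of the paper, `splitK_spec`, in the middle range of `Q₂`, and trivially at
the two ends); `T̃_k(t) = [pat t = k]` on the squarefree support (`WF.Tpow_apply_of_dvd`), whence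
`∑_{k ∈ 𝒰} wfLam k (d) = Λ⁺_z(d)` for `d ∣ P(z)`, `u ≤ z ≤ D` (`WF.sum_wfLam_eq_LamZ`), while off the divisors of
`P(z)` a value `wfLam k (q) ≠ 0` forces `p² ∣ q` for a prime `u ≤ p < z`, `u = D^{ε²}`
(`WF.exists_sq_dvd_of_wfLam_ne_zero`).  Consequently (`WF.sum_LamZ_mul_eq`, `WF.abs_junk_le`) for every `r`,
`∑_{d ∣ P(z)} Λ⁺_z(d) r(d) = ∑_{k ∈ 𝒰} ∑_{1 ≤ q ≤ Q} wfLam k (q) r(q) − (junk)`, `|junk| ≤ #𝒰 · ∑_{q ∈ junkSet} |r(q)|`,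
and, for a sifted sequence `A` (`SieveSequence`) whose density satisfies Iwaniec's `Ω(1, K)`
(`HasIwaniecDimension A.density 1 K`), in the main regime of `Core.main_regime_bounds`, **the linear sieve upper
bound with well-factorable remainder** (`WF.sifted_le_wellFactorable`):
`S(A, z) ≤ X V(z) (F(log D/log z) + 5·10²⁴(1+C_d)²(ε + ε⁻⁸ eᴷ/log D)) + ∑_{k ∈ 𝒰} ∑_{q ≤ Q} wfLam k (q) r(A, q)
 + #𝒰 ∑_{q ∈ junkSet} |r(A, q)|` — the form in which Bombieri–Friedlander–Iwaniec (Acta Math. 156 (1986), §1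
Corollary 2, §17 p. 251) consume "the linear sieve result of [15]".  Everything is PROVED; no facts.

## References

* H. Iwaniec, *A new form of the error term in the linear sieve*, Acta Arith. 37 (1980), 307–320, Theorem 1,
  Lemma 1 p. 312, (9) p. 309. [IwaniecActaArith1980b]
* E. Bombieri, J. B. Friedlander, H. Iwaniec, *Primes in arithmetic progressions to large moduli*, Acta Math.
  156 (1986), 203–251, §1 (Definition, Theorem 10, Corollary 2), §17. [BombieriFriedlanderIwaniecActa1986]
-/

open Finset Real
open scoped ArithmeticFunction.Moebius

noncomputable section

namespace Literature.NumberTheory.Sieve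

namespace Iwaniec1980b

namespace WF

/-! ### Arithmetic functions supported on numbers built from a given set of primes -/

/-- `SuppIn S F`: `F(n) ≠ 0` only if every prime factor of `n` satisfies `S`. [folklore] -/
def SuppIn (S : ℕ → Prop) (F : ArithmeticFunction ℝ) : Prop :=
  ∀ n, F n ≠ 0 → ∀ p ∈ n.primeFactors, S p

variable {S S' : ℕ → Prop} {F G : ArithmeticFunction ℝ}

/-- A nonzero value of a Dirichlet product comes from a pair of nonzero values. [folklore] -/
theorem exists_of_mul_apply_ne_zero {n : ℕ} (h : (F * G) n ≠ 0) :
    ∃ a b : ℕ, a * b = n ∧ n ≠ 0 ∧ F a ≠ 0 ∧ G b ≠ 0 := by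
  rw [ArithmeticFunction.mul_apply] at h
  obtain ⟨x, hx, hne⟩ := Finset.exists_ne_zero_of_sum_ne_zero h
  rw [Nat.mem_divisorsAntidiagonal] at hx
  exact ⟨x.1, x.2, hx.1, hx.2, left_ne_zero_of_mul hne, right_ne_zero_of_mul hne⟩

/-- `SuppIn` is monotone in the set of primes. [folklore] -/
theorem SuppIn.mono (h : ∀ p, S p → S' p) (hF : SuppIn S F) : SuppIn S' F :=
  fun n hn p hp => h p (hF n hn p hp)

/-- `SuppIn` is preserved by Dirichlet products. [folklore] -/
theorem SuppIn.mul (hF : SuppIn S F) (hG : SuppIn S G) : SuppIn S (F * G) := by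
  intro n hn p hp
  obtain ⟨a, b, rfl, hn0, ha, hb⟩ := exists_of_mul_apply_ne_zero hn
  rw [Nat.primeFactors_mul (left_ne_zero_of_mul hn0) (right_ne_zero_of_mul hn0), Finset.mem_union] at hp
  rcases hp with hp | hp
  · exact hF a ha p hp
  · exact hG b hb p hp

/-- `SuppIn` is preserved by scalar multiplication. [folklore] -/
theorem SuppIn.smul (c : ℝ) (hF : SuppIn S F) : SuppIn S (c • F) := by
  intro n hn p hp
  rw [ArithmeticFunction.smul_map, smul_eq_mul] at hn
  exact hF n (right_ne_zero_of_mul hn) p hp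

/-- `δ₁` is supported on `{1}`. [folklore] -/
theorem suppIn_one : SuppIn S (1 : ArithmeticFunction ℝ) := by
  intro n hn p hp
  rw [ArithmeticFunction.one_apply] at hn
  split_ifs at hn with h1
  · subst h1; simp at hp
  · exact absurd rfl hn

/-- `SuppIn` is preserved by powers. [folklore] -/
theorem SuppIn.pow (hF : SuppIn S F) : ∀ r : ℕ, SuppIn S (F ^ r)
  | 0 => by rw [pow_zero]; exact suppIn_one
  | r + 1 => by rw [pow_succ]; exact (SuppIn.pow hF r).mul hF

/-- `SuppIn` is preserved by finite products. [folklore] -/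
theorem SuppIn.prod {ι : Type*} (s : Finset ι) (Fi : ι → ArithmeticFunction ℝ)
    (h : ∀ i ∈ s, SuppIn S (Fi i)) : SuppIn S (∏ i ∈ s, Fi i) := by
  classical
  induction s using Finset.induction_on with
  | empty => rw [Finset.prod_empty]; exact suppIn_one
  | insert i s hi ih =>
    rw [Finset.prod_insert hi]
    exact (h i (Finset.mem_insert_self i s)).mul (ih fun j hj => h j (Finset.mem_insert_of_mem hj))

/-- Functions supported on disjoint sets of primes have coprime supports. [folklore] -/
theorem coprime_of_suppIn (hSS' : ∀ p, S p → S' p → False) (hF : SuppIn S F) (hG : SuppIn S' G)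
    {a b : ℕ} (ha : F a ≠ 0) (hb : G b ≠ 0) : Nat.Coprime a b := by
  have ha0 : a ≠ 0 := by rintro rfl; exact ha F.map_zero
  have hb0 : b ≠ 0 := by rintro rfl; exact hb G.map_zero
  rw [← Nat.disjoint_primeFactors ha0 hb0, Finset.disjoint_left]
  intro p hpa hpb
  exact hSS' p (hF a ha p hpa) (hG b hb p hpb)

/-- **Unique factorisation across coprime supports.**  If `F a ≠ 0`, `G b ≠ 0` forces `(a, b) = 1`, then a
pair `(a, b)` with `a b = n`, `F a ≠ 0`, `G b ≠ 0` is the only contributing pair, so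
`(F ⋆ G)(n) = F(a) G(b)`. [folklore] -/
theorem mul_apply_eq_of_coprime (hcop : ∀ a b, F a ≠ 0 → G b ≠ 0 → Nat.Coprime a b)
    {n a b : ℕ} (habn : a * b = n) (ha : F a ≠ 0) (hb : G b ≠ 0) : (F * G) n = F a * G b := by
  have ha0 : a ≠ 0 := by rintro rfl; exact ha F.map_zero
  have hb0 : b ≠ 0 := by rintro rfl; exact hb G.map_zero
  have hn0 : n ≠ 0 := by rw [← habn]; exact mul_ne_zero ha0 hb0
  rw [ArithmeticFunction.mul_apply]
  rw [Finset.sum_eq_single (a, b)]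
  · intro x hx hne
    rw [Nat.mem_divisorsAntidiagonal] at hx
    by_contra h
    have hxa : F x.1 ≠ 0 := left_ne_zero_of_mul h
    have hxb : G x.2 ≠ 0 := right_ne_zero_of_mul h
    -- `x.1 = a`
    have h1 : x.1 ∣ a :=
      (hcop x.1 b hxa hb).dvd_of_dvd_mul_right (by rw [habn, ← hx.1]; exact dvd_mul_right _ _)
    have h2 : a ∣ x.1 :=
      (hcop a x.2 ha hxb).dvd_of_dvd_mul_right (by rw [hx.1, ← habn]; exact dvd_mul_right _ _)
    have heq1 : x.1 = a := Nat.dvd_antisymm h1 h2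
    have heq2 : x.2 = b := by
      have : a * x.2 = a * b := by rw [← heq1, hx.1, ← habn, heq1]
      exact mul_left_cancel₀ ha0 this
    exact hne (Prod.ext heq1 heq2)
  · intro h
    exact absurd (Nat.mem_divisorsAntidiagonal.mpr ⟨habn, hn0⟩) h

/-- Under coprime supports, `(F ⋆ G)(n)` is either `0` or a single product `F(a) G(b)`, `a b = n`.
[folklore] -/
theorem mul_apply_eq_zero_or (hcop : ∀ a b, F a ≠ 0 → G b ≠ 0 → Nat.Coprime a b) (n : ℕ) :
    (F * G) n = 0 ∨ ∃ a b : ℕ, a * b = n ∧ F a ≠ 0 ∧ G b ≠ 0 ∧ (F * G) n = F a * G b := by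
  by_cases h : (F * G) n = 0
  · exact Or.inl h
  · obtain ⟨a, b, habn, -, ha, hb⟩ := exists_of_mul_apply_ne_zero h
    exact Or.inr ⟨a, b, habn, ha, hb, mul_apply_eq_of_coprime hcop habn ha hb⟩

/-- If every contributing pair of `(F ⋆ G)(n)` has first coordinate `a`, then `(F ⋆ G)(n) = F(a) G(n/a)`.
[folklore] -/
theorem mul_apply_eq_of_forall_eq {n a b : ℕ} (habn : a * b = n) (hn : n ≠ 0)
    (huniq : ∀ x y : ℕ, x * y = n → F x ≠ 0 → G y ≠ 0 → x = a) : (F * G) n = F a * G b := by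
  have ha0 : a ≠ 0 := by rintro rfl; rw [zero_mul] at habn; exact hn habn.symm
  rw [ArithmeticFunction.mul_apply, Finset.sum_eq_single (a, b)]
  · intro x hx hne
    rw [Nat.mem_divisorsAntidiagonal] at hx
    by_contra h
    have heq1 : x.1 = a := huniq x.1 x.2 hx.1 (left_ne_zero_of_mul h) (right_ne_zero_of_mul h)
    have heq2 : x.2 = b := by
      have : a * x.2 = a * b := by rw [← heq1, hx.1, ← habn, heq1]
      exact mul_left_cancel₀ ha0 this
    exact hne (Prod.ext heq1 heq2)
  · intro h
    exact absurd (Nat.mem_divisorsAntidiagonal.mpr ⟨habn, hn⟩) h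

/-- A Dirichlet product of nonnegative functions is nonnegative. [folklore] -/
theorem mul_apply_nonneg (hF : ∀ n, 0 ≤ F n) (hG : ∀ n, 0 ≤ G n) (n : ℕ) : 0 ≤ (F * G) n := by
  rw [ArithmeticFunction.mul_apply]
  exact Finset.sum_nonneg fun x _ => mul_nonneg (hF _) (hG _)

/-- Under coprime supports, bounds multiply: `|F| ≤ A`, `|G| ≤ B` give `|F ⋆ G| ≤ A B`. [folklore] -/
theorem abs_mul_apply_le (hcop : ∀ a b, F a ≠ 0 → G b ≠ 0 → Nat.Coprime a b) {A B : ℝ} (hA : 0 ≤ A)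
    (hB : 0 ≤ B) (hF : ∀ n, |F n| ≤ A) (hG : ∀ n, |G n| ≤ B) (n : ℕ) : |(F * G) n| ≤ A * B := by
  rcases mul_apply_eq_zero_or hcop n with h | ⟨a, b, -, -, -, h⟩
  · rw [h, abs_zero]; exact mul_nonneg hA hB
  · rw [h, abs_mul]; exact mul_le_mul (hF a) (hG b) (abs_nonneg _) hA

/-- Supports multiply: if `F` lives on `n ≤ X` and `G` on `n ≤ Y` then `F ⋆ G` lives on `n ≤ X Y`.
[folklore] -/
theorem le_of_mul_apply_ne_zero {X Y : ℝ} (hF : ∀ n, F n ≠ 0 → (n : ℝ) ≤ X) (hG : ∀ n, G n ≠ 0 → (n : ℝ) ≤ Y)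
    {n : ℕ} (h : (F * G) n ≠ 0) : (n : ℝ) ≤ X * Y := by
  obtain ⟨a, b, rfl, -, ha, hb⟩ := exists_of_mul_apply_ne_zero h
  push_cast
  exact mul_le_mul (hF a ha) (hG b hb) (Nat.cast_nonneg b) ((Nat.cast_nonneg a).trans (hF a ha))

/-- `(c • F)(n) = c F(n)` (pointwise scalar action). [folklore] -/
theorem smul_apply' (c : ℝ) (F : ArithmeticFunction ℝ) (n : ℕ) : (c • F) n = c * F n := rfl

/-! ### Convolution powers of the indicator of a finite set of primes -/

/-- The indicator of the primes of a finite set `T`, as an arithmetic function (non-primes of `T`, if any,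
are ignored). [folklore] -/
def primeInd (T : Finset ℕ) : ArithmeticFunction ℝ :=
  ⟨fun n => if n.Prime ∧ n ∈ T then 1 else 0, by simp [Nat.not_prime_zero]⟩

/-- Unfolding `primeInd`. [folklore] -/
theorem primeInd_apply (T : Finset ℕ) (n : ℕ) : primeInd T n = if n.Prime ∧ n ∈ T then 1 else 0 := rfl

/-- For squarefree `n` and a prime factor `p`: the prime factors of `n / p` are those of `n` except `p`.
[folklore] -/
theorem primeFactors_div_of_squarefree {n p : ℕ} (hn : Squarefree n) (hp : p ∈ n.primeFactors) :
    (n / p).primeFactors = n.primeFactors.erase p := by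
  have hpp := Nat.prime_of_mem_primeFactors hp
  have hpn := Nat.dvd_of_mem_primeFactors hp
  have hn0 := hn.ne_zero
  have hq0 : n / p ≠ 0 := (Nat.div_pos (Nat.le_of_dvd (Nat.pos_of_ne_zero hn0) hpn) hpp.pos).ne'
  have hnd : p ∉ (n / p).primeFactors := by
    intro h
    have hd : p ∣ n / p := Nat.dvd_of_mem_primeFactors h
    have hpp2 : p * p ∣ n := by
      have := Nat.mul_dvd_mul_left p hd
      rwa [Nat.mul_div_cancel' hpn] at this
    have hu := hn p hpp2
    rw [Nat.isUnit_iff] at hu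
    exact hpp.one_lt.ne' hu
  have hmul : n.primeFactors = insert p (n / p).primeFactors := by
    conv_lhs => rw [← Nat.div_mul_cancel hpn, Nat.primeFactors_mul hq0 hpp.ne_zero, hpp.primeFactors,
      Finset.union_comm, ← Finset.insert_eq]
  rw [hmul, Finset.erase_insert hnd]

section PrimeInd

variable (T : Finset ℕ)

/-- `primeInd T` lives on the primes of `T`. [folklore] -/
theorem suppIn_primeInd : SuppIn (fun p => p.Prime ∧ p ∈ T) (primeInd T) := by
  intro n hn p hp
  rw [primeInd_apply] at hn
  split_ifs at hn with h
  · have : p = n := by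
      rw [h.1.primeFactors, Finset.mem_singleton] at hp; exact hp
    subst this; exact h
  · exact absurd rfl hn

/-- `0 ≤ primeInd T ≤ 1`. [folklore] -/
theorem primeInd_apply_mem (n : ℕ) : 0 ≤ primeInd T n ∧ primeInd T n ≤ 1 := by
  rw [primeInd_apply]; split_ifs <;> norm_num

/-- The powers `E^{⋆ r}` live on numbers all of whose prime factors are primes of `T`. [folklore] -/
theorem suppIn_primeInd_pow (r : ℕ) : SuppIn (fun p => p.Prime ∧ p ∈ T) (primeInd T ^ r) :=
  (suppIn_primeInd T).pow r

/-- The recursion `E^{⋆(r+1)}(n) = ∑_{p ∣ n, p ∈ T} E^{⋆ r}(n/p)`. [folklore] -/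
theorem primeInd_pow_succ_apply (r n : ℕ) :
    (primeInd T ^ (r + 1)) n =
      ∑ p ∈ n.divisors.filter (fun p => p.Prime ∧ p ∈ T), (primeInd T ^ r) (n / p) := by
  rw [pow_succ, ArithmeticFunction.mul_apply,
    Nat.sum_divisorsAntidiagonal' (fun a b => (primeInd T ^ r) a * primeInd T b), Finset.sum_filter]
  refine Finset.sum_congr rfl fun p _ => ?_
  rw [primeInd_apply]
  split_ifs <;> simp

/-- `E^{⋆ r} ≥ 0`. [folklore] -/
theorem primeInd_pow_apply_nonneg : ∀ (r n : ℕ), 0 ≤ (primeInd T ^ r) n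
  | 0, n => by rw [pow_zero, ArithmeticFunction.one_apply]; split_ifs <;> norm_num
  | r + 1, n => by
    rw [pow_succ]
    exact mul_apply_nonneg (primeInd_pow_apply_nonneg r) (fun m => (primeInd_apply_mem T m).1) n

/-- `E^{⋆ r}(n) ≠ 0` forces `Ω(n) = r` (`n` is a product of `r` primes of `T`). [folklore] -/
theorem cardFactors_eq_of_primeInd_pow_ne_zero :
    ∀ (r : ℕ) {n : ℕ}, (primeInd T ^ r) n ≠ 0 → ArithmeticFunction.cardFactors n = r
  | 0, n, h => by
    rw [pow_zero, ArithmeticFunction.one_apply] at h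
    split_ifs at h with h1
    · subst h1; exact ArithmeticFunction.cardFactors_one
    · exact absurd rfl h
  | r + 1, n, h => by
    rw [pow_succ] at h
    obtain ⟨a, b, rfl, hn0, ha, hb⟩ := exists_of_mul_apply_ne_zero h
    have hbp : b.Prime := by
      rw [primeInd_apply] at hb
      split_ifs at hb with h'
      · exact h'.1
      · exact absurd rfl hb
    rw [ArithmeticFunction.cardFactors_mul (left_ne_zero_of_mul hn0) (right_ne_zero_of_mul hn0),
      cardFactors_eq_of_primeInd_pow_ne_zero r ha, ArithmeticFunction.cardFactors_apply_prime hbp]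

omit T in
/-- `ν(n) ≤ Ω(n)`. [folklore] -/
theorem card_primeFactors_le_cardFactors (n : ℕ) : n.primeFactors.card ≤ ArithmeticFunction.cardFactors n := by
  rw [ArithmeticFunction.cardFactors_apply]
  change n.primeFactorsList.toFinset.card ≤ _
  rw [List.card_toFinset]
  exact (List.dedup_sublist _).length_le

/-- **`E^{⋆ r}(n) ≤ r!`** (the number of ordered `r`-tuples of primes with product `n` is a multinomial
coefficient `r!/∏ aᵢ! ≤ r!`). [folklore] -/
theorem primeInd_pow_apply_le_factorial : ∀ (r n : ℕ), (primeInd T ^ r) n ≤ r.factorial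
  | 0, n => by
    rw [pow_zero, ArithmeticFunction.one_apply, Nat.factorial_zero, Nat.cast_one]
    split_ifs <;> norm_num
  | r + 1, n => by
    by_cases h0 : (primeInd T ^ (r + 1)) n = 0
    · rw [h0]; positivity
    have hΩ := cardFactors_eq_of_primeInd_pow_ne_zero T (r + 1) h0
    rw [primeInd_pow_succ_apply]
    calc ∑ p ∈ n.divisors.filter (fun p => p.Prime ∧ p ∈ T), (primeInd T ^ r) (n / p)
        ≤ ∑ p ∈ n.primeFactors, (primeInd T ^ r) (n / p) := by
          refine Finset.sum_le_sum_of_subset_of_nonneg ?_ (fun p _ _ => primeInd_pow_apply_nonneg T r _)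
          intro p hp
          rw [Finset.mem_filter] at hp
          exact Nat.mem_primeFactors.mpr ⟨hp.2.1, Nat.dvd_of_mem_divisors hp.1, (Nat.mem_divisors.mp hp.1).2⟩
      _ ≤ ∑ _p ∈ n.primeFactors, (r.factorial : ℝ) :=
          Finset.sum_le_sum fun p _ => primeInd_pow_apply_le_factorial r _
      _ = n.primeFactors.card * r.factorial := by rw [Finset.sum_const, nsmul_eq_mul]
      _ ≤ ((r + 1 : ℕ) : ℝ) * r.factorial := by
          gcongr
          calc n.primeFactors.card ≤ ArithmeticFunction.cardFactors n := card_primeFactors_le_cardFactors n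
            _ = r + 1 := hΩ
      _ = ((r + 1).factorial : ℝ) := by rw [Nat.factorial_succ]; push_cast; ring

/-- Support size: if every prime of `T` is `≤ b` then `E^{⋆ r}(n) ≠ 0` forces `n ≤ b^r`. [folklore] -/
theorem le_pow_of_primeInd_pow_ne_zero {b : ℝ} (hb0 : 0 ≤ b) (hb : ∀ p ∈ T, p.Prime → (p : ℝ) ≤ b) :
    ∀ (r : ℕ) {n : ℕ}, (primeInd T ^ r) n ≠ 0 → (n : ℝ) ≤ b ^ r
  | 0, n, h => by
    rw [pow_zero, ArithmeticFunction.one_apply] at h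
    split_ifs at h with h1
    · subst h1; simp
    · exact absurd rfl h
  | r + 1, n, h => by
    rw [pow_succ] at h
    rw [pow_succ]
    refine le_of_mul_apply_ne_zero (fun m hm => le_pow_of_primeInd_pow_ne_zero hb0 hb r hm) (fun m hm => ?_) h
    rw [primeInd_apply] at hm
    split_ifs at hm with h'
    · exact hb m h'.2 h'.1
    · exact absurd rfl hm

/-- **On squarefree numbers `E^{⋆ r}` is `r!` times the indicator of "`r` distinct primes of `T`"**:
for squarefree `n` with all prime factors in `T`, `E^{⋆ r}(n) = r! [ν(n) = r]`. [folklore] -/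
theorem primeInd_pow_apply_of_squarefree :
    ∀ (r : ℕ) {n : ℕ}, Squarefree n → (∀ p ∈ n.primeFactors, p ∈ T) →
      (primeInd T ^ r) n = if n.primeFactors.card = r then (r.factorial : ℝ) else 0
  | 0, n, hn, hT => by
    rw [pow_zero, ArithmeticFunction.one_apply, Nat.factorial_zero, Nat.cast_one]
    have hn0 := hn.ne_zero
    by_cases h1 : n = 1
    · subst h1; simp
    · rw [if_neg h1, if_neg]
      rw [Finset.card_eq_zero, Nat.primeFactors_eq_empty, not_or]
      exact ⟨hn0, h1⟩
  | r + 1, n, hn, hT => by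
    rw [primeInd_pow_succ_apply]
    have hfilt : n.divisors.filter (fun p => p.Prime ∧ p ∈ T) = n.primeFactors := by
      ext p
      rw [Finset.mem_filter, Nat.mem_divisors, Nat.mem_primeFactors]
      constructor
      · rintro ⟨⟨hd, hn0⟩, hp, -⟩; exact ⟨hp, hd, hn0⟩
      · rintro ⟨hp, hd, hn0⟩; exact ⟨⟨hd, hn0⟩, hp, hT p (Nat.mem_primeFactors.mpr ⟨hp, hd, hn0⟩)⟩
    rw [hfilt]
    have hterm : ∀ p ∈ n.primeFactors, (primeInd T ^ r) (n / p) =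
        if n.primeFactors.card = r + 1 then (r.factorial : ℝ) else 0 := by
      intro p hp
      have hpn := Nat.dvd_of_mem_primeFactors hp
      have hsq : Squarefree (n / p) := hn.squarefree_of_dvd (Nat.div_dvd_of_dvd hpn)
      have hpf : (n / p).primeFactors = n.primeFactors.erase p := primeFactors_div_of_squarefree hn hp
      rw [primeInd_pow_apply_of_squarefree r hsq (fun q hq => hT q (by
        rw [hpf] at hq; exact Finset.mem_of_mem_erase hq)), hpf, Finset.card_erase_of_mem hp]
      have hc : 0 < n.primeFactors.card := Finset.card_pos.mpr ⟨p, hp⟩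
      by_cases h : n.primeFactors.card = r + 1
      · rw [if_pos (by omega), if_pos h]
      · rw [if_neg (by omega), if_neg h]
    rw [Finset.sum_congr rfl hterm, Finset.sum_const, nsmul_eq_mul]
    split_ifs with h
    · rw [h, Nat.factorial_succ]; push_cast; ring
    · rw [mul_zero]

end PrimeInd

/-! ### Products over distinct boxes: supports, bounds -/

/-- **Products of `[0, 1]`-valued functions living on pairwise disjoint sets of primes** are `[0, 1]`-valued
and live on the union. [folklore] -/
theorem prod_props (B : Finset ℕ) (Gf : ℕ → ArithmeticFunction ℝ) (Sf : ℕ → ℕ → Prop)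
    (hdisj : ∀ i j p, i ≠ j → Sf i p → Sf j p → False)
    (hsupp : ∀ j ∈ B, SuppIn (Sf j) (Gf j)) (h01 : ∀ j ∈ B, ∀ n, 0 ≤ Gf j n ∧ Gf j n ≤ 1) :
    SuppIn (fun p => ∃ j ∈ B, Sf j p) (∏ j ∈ B, Gf j) ∧
      ∀ n, 0 ≤ (∏ j ∈ B, Gf j) n ∧ (∏ j ∈ B, Gf j) n ≤ 1 := by
  classical
  induction B using Finset.induction_on with
  | empty =>
    rw [Finset.prod_empty]
    refine ⟨(suppIn_one (S := fun _ => False)).mono fun p h => h.elim, fun n => ?_⟩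
    rw [ArithmeticFunction.one_apply]; split_ifs <;> norm_num
  | insert i B hi ih =>
    obtain ⟨ihS, ih01⟩ := ih (fun j hj => hsupp j (Finset.mem_insert_of_mem hj))
      (fun j hj => h01 j (Finset.mem_insert_of_mem hj))
    have hSi := hsupp i (Finset.mem_insert_self i B)
    have h01i := h01 i (Finset.mem_insert_self i B)
    rw [Finset.prod_insert hi]
    have hcop : ∀ a b, Gf i a ≠ 0 → (∏ j ∈ B, Gf j) b ≠ 0 → Nat.Coprime a b :=
      fun a b ha hb => coprime_of_suppIn (S := Sf i) (S' := fun p => ∃ j ∈ B, Sf j p)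
        (fun p hp hq => by
          obtain ⟨j, hj, hjp⟩ := hq
          exact hdisj i j p (fun h => hi (h ▸ hj)) hp hjp) hSi ihS ha hb
    refine ⟨?_, fun n => ⟨mul_apply_nonneg (fun m => (h01i m).1) (fun m => (ih01 m).1) n, ?_⟩⟩
    · refine (hSi.mono fun p hp => ⟨i, Finset.mem_insert_self i B, hp⟩).mul (ihS.mono fun p hp => ?_)
      obtain ⟨j, hj, hjp⟩ := hp
      exact ⟨j, Finset.mem_insert_of_mem hj, hjp⟩
    · have h := abs_mul_apply_le hcop zero_le_one zero_le_one
        (fun m => abs_le.mpr ⟨by linarith [(h01i m).1], (h01i m).2⟩)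
        (fun m => abs_le.mpr ⟨by linarith [(ih01 m).1], (ih01 m).2⟩) n
      rw [mul_one] at h
      exact (le_abs_self _).trans h

/-- Support sizes multiply over a product. [folklore] -/
theorem le_prod_of_prod_apply_ne_zero (B : Finset ℕ) (Gf : ℕ → ArithmeticFunction ℝ) (X : ℕ → ℝ)
    (hX : ∀ j ∈ B, ∀ n, Gf j n ≠ 0 → (n : ℝ) ≤ X j) {n : ℕ} (h : (∏ j ∈ B, Gf j) n ≠ 0) :
    (n : ℝ) ≤ ∏ j ∈ B, X j := by
  classical
  induction B using Finset.induction_on generalizing n with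
  | empty =>
    rw [Finset.prod_empty, ArithmeticFunction.one_apply] at h
    rw [Finset.prod_empty]
    split_ifs at h with h1
    · subst h1; simp
    · exact absurd rfl h
  | insert i B hi ih =>
    rw [Finset.prod_insert hi] at h ⊢
    exact le_of_mul_apply_ne_zero (hX i (Finset.mem_insert_self i B))
      (fun m hm => ih (fun j hj => hX j (Finset.mem_insert_of_mem hj)) hm) h

/-! ### The boxes of primes in `[u, z)` and the normalised powers `(r!)⁻¹ E_j^{⋆ r}` -/

section Boxes

variable {D ε : ℝ} (hD : 1 < D) (hε : 0 < ε)

/-- The primes of box `j` in the range `[u, z)`: `u ≤ p < z`, `boxIdx p = j` (so `D_j ≤ p < D_{j+1}`).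
[cite: IwaniecActaArith1980b, §4 p. 315] -/
def boxPrimes (z : ℝ) (j : ℕ) : Finset ℕ :=
  (Nat.primesBelow ⌈z⌉₊).filter (fun p : ℕ => Core.uu D ε ≤ (p : ℝ) ∧ boxIdx hD hε (Core.eta_pos hε) p = j)

/-- Membership in `boxPrimes`. [folklore] -/
theorem mem_boxPrimes {z : ℝ} {j p : ℕ} :
    p ∈ boxPrimes hD hε z j ↔ p.Prime ∧ (p : ℝ) < z ∧ Core.uu D ε ≤ (p : ℝ) ∧ boxIdx hD hε (Core.eta_pos hε) p = j := by
  rw [boxPrimes, Finset.mem_filter, Nat.mem_primesBelow, Nat.lt_ceil]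
  tauto

/-- The normalised convolution power `(r!)⁻¹ E_j^{⋆ r}` of the indicator of the primes of box `j`.
[folklore] -/
def Gbox (z : ℝ) (j r : ℕ) : ArithmeticFunction ℝ :=
  ((r.factorial : ℝ)⁻¹) • primeInd (boxPrimes hD hε z j) ^ r

/-- `Gbox z j 0 = δ₁`. [folklore] -/
theorem Gbox_zero (z : ℝ) (j : ℕ) : Gbox hD hε z j 0 = 1 := by
  rw [Gbox, pow_zero, Nat.factorial_zero, Nat.cast_one, inv_one, one_smul]

/-- **Exact factorisation of the powers**: `Gbox j a ⋆ Gbox j b = C(a+b, a) • Gbox j (a+b)`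
(`(a! b!)⁻¹ = C(a+b,a) ((a+b)!)⁻¹`). [folklore] -/
theorem Gbox_mul_Gbox (z : ℝ) (j a b : ℕ) :
    Gbox hD hε z j a * Gbox hD hε z j b = ((a + b).choose a : ℝ) • Gbox hD hε z j (a + b) := by
  rw [Gbox, Gbox, Gbox, smul_mul_smul_comm, ← pow_add, smul_smul]
  congr 1
  have ha : (a.factorial : ℝ) ≠ 0 := by positivity
  have hb : (b.factorial : ℝ) ≠ 0 := by positivity
  have hab : ((a + b).factorial : ℝ) ≠ 0 := by positivity
  have h := Nat.add_choose_mul_factorial_mul_factorial a b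
  rw [← Nat.choose_symm_add] at h
  -- `(a+b).choose a * a! * b! = (a+b)!`
  have h' : ((a + b).choose a : ℝ) * a.factorial * b.factorial = (a + b).factorial := by exact_mod_cast h
  field_simp
  linarith [h']

/-- `Gbox` lives on numbers all of whose prime factors are primes of the box. [folklore] -/
theorem suppIn_Gbox (z : ℝ) (j r : ℕ) :
    SuppIn (fun p => p.Prime ∧ p ∈ boxPrimes hD hε z j) (Gbox hD hε z j r) :=
  (suppIn_primeInd_pow _ r).smul _

/-- `0 ≤ Gbox ≤ 1` (from `0 ≤ E^{⋆ r} ≤ r!`). [folklore] -/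
theorem Gbox_apply_mem (z : ℝ) (j r n : ℕ) : 0 ≤ Gbox hD hε z j r n ∧ Gbox hD hε z j r n ≤ 1 := by
  rw [Gbox, smul_apply']
  have hf : (0 : ℝ) < r.factorial := by exact_mod_cast Nat.factorial_pos r
  refine ⟨mul_nonneg (inv_nonneg.mpr hf.le) (primeInd_pow_apply_nonneg _ r n), ?_⟩
  rw [inv_mul_le_iff₀ hf, mul_one]
  exact primeInd_pow_apply_le_factorial _ r n

/-- Support size of `Gbox`: `n ≤ D_{j+1}^r`. [folklore] -/
theorem le_of_Gbox_ne_zero (z : ℝ) (j r : ℕ) {n : ℕ} (h : Gbox hD hε z j r n ≠ 0) :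
    (n : ℝ) ≤ grid D ε (Core.eta ε) (j + 1) ^ r := by
  rw [Gbox, smul_apply'] at h
  refine le_pow_of_primeInd_pow_ne_zero _ (grid_pos (by linarith) _).le (fun p hp _ => ?_) r
    (right_ne_zero_of_mul h)
  rw [mem_boxPrimes] at hp
  rw [← hp.2.2.2]
  exact (lt_grid_boxIdx_succ hD hε (Core.eta_pos hε) p).le

/-- On a squarefree number whose primes lie in the box, `Gbox j r` is the indicator of `ν = r`. [folklore] -/
theorem Gbox_apply_of_squarefree (z : ℝ) (j r : ℕ) {n : ℕ} (hn : Squarefree n)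
    (hT : ∀ p ∈ n.primeFactors, p ∈ boxPrimes hD hε z j) :
    Gbox hD hε z j r n = if n.primeFactors.card = r then 1 else 0 := by
  rw [Gbox, smul_apply', primeInd_pow_apply_of_squarefree _ r hn hT]
  have hf : (r.factorial : ℝ) ≠ 0 := by positivity
  split_ifs
  · rw [inv_mul_cancel₀ hf]
  · rw [mul_zero]

/-- Distinct boxes have disjoint sets of primes. [folklore] -/
theorem boxPrimes_disjoint (z : ℝ) : ∀ i j p, i ≠ j →
    (p.Prime ∧ p ∈ boxPrimes hD hε z i) → (p.Prime ∧ p ∈ boxPrimes hD hε z j) → False := by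
  intro i j p hij hi hj
  rw [mem_boxPrimes] at hi hj
  exact hij (hi.2.2.2.2.symm.trans hj.2.2.2.2)

omit hD hε in
/-- `∏ (bᵢ • fᵢ) = (∏ bᵢ) • ∏ fᵢ` in the `ℝ`-algebra of arithmetic functions. [folklore] -/
theorem prod_smul_eq (s : Finset ℕ) (b : ℕ → ℝ) (f : ℕ → ArithmeticFunction ℝ) :
    ∏ i ∈ s, b i • f i = (∏ i ∈ s, b i) • ∏ i ∈ s, f i := by
  classical
  induction s using Finset.induction_on with
  | empty => simp
  | insert i s hi ih => rw [Finset.prod_insert hi, Finset.prod_insert hi, Finset.prod_insert hi, ih, smul_mul_smul_comm]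

/-! ### The normalised powers over a multiset of boxes: `T̃_m` -/

/-- `T̃_m = ∏_{j ∈ m} (m(j)!)⁻¹ E_j^{⋆ m(j)}` (product over the distinct boxes of `m`): the exactly-factorable
replacement for the indicator of "pattern `= m`". [folklore] -/
def Tpow (z : ℝ) (m : Multiset ℕ) : ArithmeticFunction ℝ :=
  ∏ j ∈ m.toFinset, Gbox hD hε z j (m.count j)

/-- `T̃_m` as a product over any finite set of boxes containing those of `m`. [folklore] -/
theorem Tpow_eq_prod {z : ℝ} {m : Multiset ℕ} {B : Finset ℕ} (hB : m.toFinset ⊆ B) :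
    Tpow hD hε z m = ∏ j ∈ B, Gbox hD hε z j (m.count j) := by
  rw [Tpow]
  refine Finset.prod_subset hB fun j _ hj => ?_
  rw [Multiset.mem_toFinset, ← Multiset.count_eq_zero] at hj
  rw [hj, Gbox_zero]

/-- **Exact factorisation over a split of the pattern**: `T̃_{m₁} ⋆ T̃_{m₂} = c • T̃_{m₁ + m₂}` with
`c = ∏_j C((m₁+m₂)(j), m₁(j))` (`binomK`). [folklore] -/
theorem Tpow_mul_Tpow (z : ℝ) (m₁ m₂ : Multiset ℕ) :
    Tpow hD hε z m₁ * Tpow hD hε z m₂ =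
      (binomK (m₁ + m₂).toFinset (m₁ + m₂) m₁ : ℝ) • Tpow hD hε z (m₁ + m₂) := by
  classical
  set B := (m₁ + m₂).toFinset with hBdef
  have h1 : m₁.toFinset ⊆ B := by
    rw [hBdef, Multiset.toFinset_add]; exact Finset.subset_union_left
  have h2 : m₂.toFinset ⊆ B := by
    rw [hBdef, Multiset.toFinset_add]; exact Finset.subset_union_right
  rw [Tpow_eq_prod hD hε h1, Tpow_eq_prod hD hε h2, Tpow_eq_prod hD hε (subset_refl B), ← Finset.prod_mul_distrib,
    binomK, Nat.cast_prod, ← prod_smul_eq]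
  refine Finset.prod_congr rfl fun j _ => ?_
  rw [Gbox_mul_Gbox, Multiset.count_add]

/-- `T̃_m` is `[0, 1]`-valued and lives on numbers whose primes lie in `[u, z)` in boxes of `m`. [folklore] -/
theorem Tpow_props (z : ℝ) (m : Multiset ℕ) :
    SuppIn (fun p => ∃ j ∈ m.toFinset, p.Prime ∧ p ∈ boxPrimes hD hε z j) (Tpow hD hε z m) ∧
      ∀ n, 0 ≤ Tpow hD hε z m n ∧ Tpow hD hε z m n ≤ 1 :=
  prod_props m.toFinset (fun j => Gbox hD hε z j (m.count j)) (fun j p => p.Prime ∧ p ∈ boxPrimes hD hε z j)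
    (boxPrimes_disjoint hD hε z) (fun j _ => suppIn_Gbox hD hε z j _) (fun j _ n => Gbox_apply_mem hD hε z j _ n)

/-- `|T̃_m| ≤ 1`. [folklore] -/
theorem abs_Tpow_le_one (z : ℝ) (m : Multiset ℕ) (n : ℕ) : |Tpow hD hε z m n| ≤ 1 := by
  have h := (Tpow_props hD hε z m).2 n
  exact abs_le.mpr ⟨by linarith [h.1], h.2⟩

/-- Support size of `T̃_m`: `n ≤ bprod m = ∏_{j ∈ m} D_{j+1}`. [folklore] -/
theorem le_bprod_of_Tpow_ne_zero (z : ℝ) (m : Multiset ℕ) {n : ℕ} (h : Tpow hD hε z m n ≠ 0) :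
    (n : ℝ) ≤ bprod (D := D) (ε := ε) (η := Core.eta ε) m := by
  have hb : bprod (D := D) (ε := ε) (η := Core.eta ε) m =
      ∏ j ∈ m.toFinset, grid D ε (Core.eta ε) (j + 1) ^ (m.count j) := by
    rw [bprod, Finset.prod_multiset_map_count]
  rw [hb]
  exact le_prod_of_prod_apply_ne_zero m.toFinset _ _ (fun j _ k hk => le_of_Gbox_ne_zero hD hε z j _ hk) h

/-- Every prime factor of a number in the support of `T̃_m` is a prime of `[u, z)`. [folklore] -/
theorem prime_range_of_Tpow_ne_zero (z : ℝ) (m : Multiset ℕ) {n : ℕ} (h : Tpow hD hε z m n ≠ 0)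
    {p : ℕ} (hp : p ∈ n.primeFactors) : Core.uu D ε ≤ (p : ℝ) ∧ (p : ℝ) < z := by
  obtain ⟨j, -, -, hj⟩ := (Tpow_props hD hε z m).1 n h p hp
  rw [mem_boxPrimes] at hj
  exact ⟨hj.2.2.1, hj.2.1⟩

end Boxes

/-! ### `T̃_k` on the squarefree support is the indicator of the pattern -/

section PatternValue

variable {D ε : ℝ} (hD : 1 < D) (hε : 0 < ε)

/-- A product of box factors evaluated at a squarefree number whose primes lie in the boxes of `B`: it is the
indicator of "box `j` carries exactly `c j` primes, for every `j ∈ B`". [folklore] -/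
theorem prod_Gbox_apply_of_squarefree (z : ℝ) (c : ℕ → ℕ) :
    ∀ (B : Finset ℕ) {t : ℕ}, Squarefree t → (∀ p ∈ t.primeFactors, ∃ j ∈ B, p ∈ boxPrimes hD hε z j) →
      (∏ j ∈ B, Gbox hD hε z j (c j)) t =
        if ∀ j ∈ B, (t.primeFactors.filter (· ∈ boxPrimes hD hε z j)).card = c j then 1 else 0 := by
  classical
  intro B
  induction B using Finset.induction_on with
  | empty =>
    intro t ht hB
    have ht1 : t = 1 := by
      have h0 : t.primeFactors = ∅ := Finset.eq_empty_of_forall_notMem fun p hp => by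
        obtain ⟨j, hj, -⟩ := hB p hp; exact Finset.notMem_empty j hj
      rcases Nat.primeFactors_eq_empty.mp h0 with h | h
      · exact absurd h ht.ne_zero
      · exact h
    subst ht1
    rw [Finset.prod_empty, ArithmeticFunction.one_apply, if_pos rfl, if_pos]
    intro j hj; exact absurd hj (Finset.notMem_empty j)
  | insert i B hi ih =>
    intro t ht hB
    have ht0 : t ≠ 0 := ht.ne_zero
    set T₀ := t.primeFactors.filter (· ∈ boxPrimes hD hε z i) with hT₀
    set t₀ := ∏ p ∈ T₀, p with ht₀
    have hT₀sub : T₀ ⊆ t.primeFactors := Finset.filter_subset _ _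
    have hprimes : ∀ p ∈ T₀, p.Prime := fun p hp => Nat.prime_of_mem_primeFactors (hT₀sub hp)
    have ht₀pf : t₀.primeFactors = T₀ := Nat.primeFactors_prod hprimes
    have ht₀dvd : t₀ ∣ t :=
      calc t₀ ∣ ∏ p ∈ t.primeFactors, p := Finset.prod_dvd_prod_of_subset _ _ _ hT₀sub
        _ = t := Nat.prod_primeFactors_of_squarefree ht
    set t₁ := t / t₀ with ht₁
    have htt : t₀ * t₁ = t := Nat.mul_div_cancel' ht₀dvd
    have ht₀0 : t₀ ≠ 0 := fun h => ht0 (by rw [← htt, h, zero_mul])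
    have ht₁0 : t₁ ≠ 0 := fun h => ht0 (by rw [← htt, h, mul_zero])
    have ht₀sq : Squarefree t₀ := ht.squarefree_of_dvd ht₀dvd
    have ht₁sq : Squarefree t₁ := ht.squarefree_of_dvd (Dvd.intro_left t₀ htt)
    have hcop : Nat.Coprime t₀ t₁ := by
      have h := ht; rw [← htt, Nat.squarefree_mul_iff] at h; exact h.1
    have hpf : t.primeFactors = t₀.primeFactors ∪ t₁.primeFactors := by
      rw [← htt, Nat.primeFactors_mul ht₀0 ht₁0]
    have hdisj : Disjoint t₀.primeFactors t₁.primeFactors := (Nat.disjoint_primeFactors ht₀0 ht₁0).mpr hcop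
    have ht₁pf : ∀ p ∈ t₁.primeFactors, p ∈ t.primeFactors ∧ p ∉ boxPrimes hD hε z i := by
      intro p hp
      have hpt : p ∈ t.primeFactors := by rw [hpf]; exact Finset.mem_union_right _ hp
      refine ⟨hpt, fun hbox => ?_⟩
      have : p ∈ t₀.primeFactors := by rw [ht₀pf, hT₀, Finset.mem_filter]; exact ⟨hpt, hbox⟩
      exact Finset.disjoint_left.mp hdisj this hp
    have hB₁ : ∀ p ∈ t₁.primeFactors, ∃ j ∈ B, p ∈ boxPrimes hD hε z j := by
      intro p hp
      obtain ⟨hpt, hnot⟩ := ht₁pf p hp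
      obtain ⟨j, hj, hjp⟩ := hB p hpt
      rw [Finset.mem_insert] at hj
      rcases hj with rfl | hj
      · exact absurd hjp hnot
      · exact ⟨j, hj, hjp⟩
    rw [Finset.prod_insert hi]
    -- the only contributing pair is `(t₀, t₁)`
    have hSB := (prod_props B (fun j => Gbox hD hε z j (c j)) (fun j p => p.Prime ∧ p ∈ boxPrimes hD hε z j)
      (boxPrimes_disjoint hD hε z) (fun j _ => suppIn_Gbox hD hε z j _) (fun j _ n => Gbox_apply_mem hD hε z j _ n)).1
    have huniq : ∀ x y : ℕ, x * y = t → Gbox hD hε z i (c i) x ≠ 0 → (∏ j ∈ B, Gbox hD hε z j (c j)) y ≠ 0 →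
        x = t₀ := by
      intro x y hxy hx hy
      have hx0 : x ≠ 0 := fun h => ht0 (by rw [← hxy, h, zero_mul])
      have hy0 : y ≠ 0 := fun h => ht0 (by rw [← hxy, h, mul_zero])
      have hxsq : Squarefree x := ht.squarefree_of_dvd (Dvd.intro y hxy)
      have hxS := suppIn_Gbox hD hε z i (c i) x hx
      have hyS := hSB y hy
      have hxpf : x.primeFactors = T₀ := by
        ext p
        rw [hT₀, Finset.mem_filter]
        constructor
        · intro hp
          refine ⟨?_, (hxS p hp).2⟩
          rw [← hxy, Nat.primeFactors_mul hx0 hy0]; exact Finset.mem_union_left _ hp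
        · rintro ⟨hpt, hbox⟩
          rw [← hxy, Nat.primeFactors_mul hx0 hy0, Finset.mem_union] at hpt
          rcases hpt with h | h
          · exact h
          · exfalso
            obtain ⟨j, hj, hpj⟩ := hyS p h
            have hne : i ≠ j := fun e => hi (e ▸ hj)
            exact boxPrimes_disjoint hD hε z i j p hne ⟨Nat.prime_of_mem_primeFactors h, hbox⟩ hpj
      calc x = ∏ p ∈ x.primeFactors, p := (Nat.prod_primeFactors_of_squarefree hxsq).symm
        _ = t₀ := by rw [hxpf]
    rw [mul_apply_eq_of_forall_eq htt ht0 huniq]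
    -- the two values
    have hv₀ : Gbox hD hε z i (c i) t₀ = if T₀.card = c i then 1 else 0 := by
      rw [Gbox_apply_of_squarefree hD hε z i (c i) ht₀sq (fun p hp => by
        rw [ht₀pf, hT₀, Finset.mem_filter] at hp; exact hp.2), ht₀pf]
    have hv₁ := ih ht₁sq hB₁
    have hfilt : ∀ j ∈ B, t₁.primeFactors.filter (· ∈ boxPrimes hD hε z j) =
        t.primeFactors.filter (· ∈ boxPrimes hD hε z j) := by
      intro j hj
      have hne : i ≠ j := fun e => hi (e ▸ hj)
      ext p
      simp only [Finset.mem_filter]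
      constructor
      · rintro ⟨hp, hbox⟩; exact ⟨(ht₁pf p hp).1, hbox⟩
      · rintro ⟨hp, hbox⟩
        refine ⟨?_, hbox⟩
        rw [hpf, Finset.mem_union] at hp
        rcases hp with h | h
        · exfalso
          rw [ht₀pf, hT₀, Finset.mem_filter] at h
          exact boxPrimes_disjoint hD hε z i j p hne ⟨Nat.prime_of_mem_primeFactors h.1, h.2⟩
            ⟨Nat.prime_of_mem_primeFactors h.1, hbox⟩
        · exact h
    rw [hv₀, hv₁]
    by_cases h0 : T₀.card = c i
    · rw [if_pos h0, one_mul]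
      by_cases h1 : ∀ j ∈ B, (t₁.primeFactors.filter (· ∈ boxPrimes hD hε z j)).card = c j
      · rw [if_pos h1, if_pos]
        intro j hj
        rw [Finset.mem_insert] at hj
        rcases hj with rfl | hj
        · exact h0
        · rw [← hfilt j hj]; exact h1 j hj
      · rw [if_neg h1, if_neg]
        intro h
        exact h1 fun j hj => by rw [hfilt j hj]; exact h j (Finset.mem_insert_of_mem hj)
    · rw [if_neg h0, zero_mul, if_neg]
      intro h
      exact h0 (h i (Finset.mem_insert_self i B))

/-- The number of primes of `t` in box `j` is the multiplicity of `j` in the pattern of `t` (for `t` with all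
primes in `[u, z)`). [folklore] -/
theorem card_filter_boxPrimes_eq_count {z : ℝ} {t : ℕ}
    (hrange : ∀ p ∈ t.primeFactors, Core.uu D ε ≤ (p : ℝ) ∧ (p : ℝ) < z) (j : ℕ) :
    (t.primeFactors.filter (· ∈ boxPrimes hD hε z j)).card = (pat hD hε (Core.eta_pos hε) t).count j := by
  classical
  rw [pat, Multiset.count_map]
  have h : t.primeFactors.filter (· ∈ boxPrimes hD hε z j) =
      t.primeFactors.filter (fun p => j = boxIdx hD hε (Core.eta_pos hε) p) := by
    refine Finset.filter_congr fun p hp => ?_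
    rw [mem_boxPrimes]
    constructor
    · intro h; exact h.2.2.2.symm
    · intro h; exact ⟨Nat.prime_of_mem_primeFactors hp, (hrange p hp).2, (hrange p hp).1, h.symm⟩
  rw [h, Finset.card_def, Finset.filter_val]

/-- **`T̃_k` on the squarefree support**: for `t ∣ P(z, u)`, `T̃_k(t) = [pat t = k]`.
[cite: IwaniecActaArith1980b, §4 p. 315 ("d belongs to the sequence (D₁, …, D_r)")] -/
theorem Tpow_apply_of_dvd (z : ℝ) (k : Multiset ℕ) {t : ℕ} (ht : t ∣ primesProdIco (Core.uu D ε) z) :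
    Tpow hD hε z k t = if pat hD hε (Core.eta_pos hε) t = k then 1 else 0 := by
  classical
  have hη := Core.eta_pos hε
  have htsq : Squarefree t := (squarefree_primesProdIco _ _).squarefree_of_dvd ht
  have hrange : ∀ p ∈ t.primeFactors, Core.uu D ε ≤ (p : ℝ) ∧ (p : ℝ) < z := fun p hp =>
    (dvd_primesProdIco_iff (Nat.prime_of_mem_primeFactors hp) _ _).mp ((Nat.dvd_of_mem_primeFactors hp).trans ht)
  have hbox : ∀ p ∈ t.primeFactors, p ∈ boxPrimes hD hε z (boxIdx hD hε hη p) := fun p hp =>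
    (mem_boxPrimes hD hε).mpr ⟨Nat.prime_of_mem_primeFactors hp, (hrange p hp).2, (hrange p hp).1, rfl⟩
  set B := k.toFinset ∪ (pat hD hε hη t).toFinset with hB
  have hkB : k.toFinset ⊆ B := Finset.subset_union_left
  rw [Tpow_eq_prod hD hε hkB, prod_Gbox_apply_of_squarefree hD hε z (fun j => k.count j) B htsq (fun p hp =>
    ⟨boxIdx hD hε hη p, Finset.mem_union_right _ (Multiset.mem_toFinset.mpr
      ((mem_pat_iff hD hε hη).mpr ⟨p, hp, rfl⟩)), hbox p hp⟩)]
  have hcount := card_filter_boxPrimes_eq_count hD hε hrange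
  by_cases h : pat hD hε hη t = k
  · rw [if_pos h, if_pos]
    intro j _; rw [hcount, h]
  · rw [if_neg h, if_neg]
    intro hall
    apply h
    ext j
    by_cases hj : j ∈ B
    · rw [← hcount, hall j hj]
    · have h1 : j ∉ k.toFinset := fun h' => hj (hkB h')
      have h2 : j ∉ (pat hD hε hη t).toFinset := fun h' => hj (Finset.mem_union_right _ h')
      rw [Multiset.mem_toFinset, ← Multiset.count_eq_zero] at h1 h2
      rw [h1, h2]

end PatternValue

/-! ### The weights `Λ̃_k = λ_k • (Φ_k ⋆ T̃_k)` -/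

section Weights

variable {D ε : ℝ} (hD : 1 < D) (hε : 0 < ε)

/-- `φ^±(0) = 0`. [folklore] -/
theorem phi_zero (par : ℕ) : Core.phi D ε par 0 = 0 := by
  unfold Core.phi
  rw [if_neg]
  rw [zero_dvd_iff]
  exact primesProdBelow_ne_zero _

/-- The sign-selected small composite `Φ_k = innerSel⁺(φ⁺, φ⁻; λ_k)` of the pattern `k`, as an arithmetic
function. [cite: IwaniecActaArith1980b, §4 (17)–(18) with Lemma 4] -/
def PhiK (k : Multiset ℕ) : ArithmeticFunction ℝ :=
  ⟨phiOf 1 (Core.phi D ε 1) (Core.phi D ε 0) (Core.Lamk (D := D) (ε := ε) 1 0) k, by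
    unfold phiOf BetaSieve.innerSel
    split_ifs <;> exact phi_zero _⟩

/-- Unfolding `PhiK`. [folklore] -/
theorem PhiK_apply (k : Multiset ℕ) (e : ℕ) :
    PhiK (D := D) (ε := ε) k e =
      BetaSieve.innerSel 1 (Core.phi D ε 1) (Core.phi D ε 0) (Core.Lamk (D := D) (ε := ε) 1 0 k) e := rfl

/-- `Φ_k(e)` is `φ⁺(e)` or `φ⁻(e)`. [folklore] -/
theorem exists_PhiK_eq (k : Multiset ℕ) (e : ℕ) : ∃ par : ℕ, PhiK (D := D) (ε := ε) k e = Core.phi D ε par e := by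
  rw [PhiK_apply]; unfold BetaSieve.innerSel
  split_ifs
  · exact ⟨1, rfl⟩
  · exact ⟨0, rfl⟩

/-- `|Φ_k| ≤ 1`. [folklore] -/
theorem abs_PhiK_le_one (k : Multiset ℕ) (e : ℕ) : |PhiK (D := D) (ε := ε) k e| ≤ 1 := by
  obtain ⟨par, h⟩ := exists_PhiK_eq (D := D) (ε := ε) k e
  rw [h]; exact Core.abs_phi_le_one par e

/-- `Φ_k(e) ≠ 0` forces `e ∣ P(u)`. [folklore] -/
theorem dvd_of_PhiK_ne_zero {k : Multiset ℕ} {e : ℕ} (h : PhiK (D := D) (ε := ε) k e ≠ 0) :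
    e ∣ primesProdBelow (Core.uu D ε) := by
  obtain ⟨par, hpar⟩ := exists_PhiK_eq (D := D) (ε := ε) k e
  rw [hpar] at h
  unfold Core.phi at h
  by_contra hnd
  rw [if_neg hnd] at h
  exact h rfl

include hD hε in
/-- `Φ_k(e) ≠ 0` forces `e < D^ε` (for `ε ≤ 1/3`). [cite: IwaniecActaArith1980b, §4 Lemma 4 (20)] -/
theorem lt_of_PhiK_ne_zero (hε3 : ε ≤ 1 / 3) {k : Multiset ℕ} {e : ℕ} (h : PhiK (D := D) (ε := ε) k e ≠ 0) :
    (e : ℝ) < D ^ ε := by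
  obtain ⟨par, hpar⟩ := exists_PhiK_eq (D := D) (ε := ε) k e
  rw [hpar] at h
  exact Core.lt_of_phi_ne_zero hD hε hε3 par h

/-- `Φ_k` lives on numbers whose primes are `< u`. [folklore] -/
theorem suppIn_PhiK (k : Multiset ℕ) : SuppIn (fun p => (p : ℝ) < Core.uu D ε) (PhiK (D := D) (ε := ε) k) := by
  intro e he p hp
  have hd := dvd_of_PhiK_ne_zero (D := D) (ε := ε) he
  exact (dvd_primesProdBelow_iff (Nat.prime_of_mem_primeFactors hp) _).mp
    ((Nat.dvd_of_mem_primeFactors hp).trans hd)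

/-- **The well-factorable weights** `Λ̃_k = λ_k • (Φ_k ⋆ T̃_k)` attached to a pattern `k` (for the upper
sieve `Λ⁺_z`). [cite: IwaniecActaArith1980b, Theorem 1 and (9) p. 309] -/
def wfLam (z : ℝ) (k : Multiset ℕ) : ArithmeticFunction ℝ :=
  Core.Lamk (D := D) (ε := ε) 1 0 k • (PhiK (D := D) (ε := ε) k * Tpow hD hε z k)

/-- `Φ_k` and `T̃_m` have coprime supports (primes `< u` versus primes `≥ u`). [folklore] -/
theorem coprime_PhiK_Tpow (z : ℝ) (k m : Multiset ℕ) :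
    ∀ a b, PhiK (D := D) (ε := ε) k a ≠ 0 → Tpow hD hε z m b ≠ 0 → Nat.Coprime a b :=
  fun _ _ ha hb => coprime_of_suppIn (fun p h1 h2 => by
      obtain ⟨j, -, -, hj⟩ := h2
      rw [mem_boxPrimes] at hj
      exact absurd h1 (not_lt.mpr hj.2.2.1)) (suppIn_PhiK (D := D) (ε := ε) k) (Tpow_props hD hε z m).1 ha hb

/-- `|Φ_k ⋆ T̃_m| ≤ 1`. [folklore] -/
theorem abs_PhiK_mul_Tpow_le_one (z : ℝ) (k m : Multiset ℕ) (n : ℕ) :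
    |(PhiK (D := D) (ε := ε) k * Tpow hD hε z m) n| ≤ 1 := by
  have h := abs_mul_apply_le (coprime_PhiK_Tpow hD hε z k m) zero_le_one zero_le_one
    (abs_PhiK_le_one (D := D) (ε := ε) k) (abs_Tpow_le_one hD hε z m) n
  rwa [mul_one] at h

/-- **`|Λ̃_k| ≤ 1`.** [cite: IwaniecActaArith1980b, Theorem 1 ("bounded by 1 in absolute value")] -/
theorem abs_wfLam_le_one (z : ℝ) (k : Multiset ℕ) (n : ℕ) : |wfLam hD hε z k n| ≤ 1 := by
  rw [wfLam, smul_apply', abs_mul]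
  exact mul_le_one₀ (Core.abs_Lamk_le_one 1 0 k) (abs_nonneg _) (abs_PhiK_mul_Tpow_le_one hD hε z k k n)

include hD hε in
/-- Support of `Φ_k ⋆ T̃_m`: `n < D^ε · bprod m`. [folklore] -/
theorem lt_of_PhiK_mul_Tpow_ne_zero (hε3 : ε ≤ 1 / 3) (z : ℝ) (k m : Multiset ℕ) {n : ℕ}
    (h : (PhiK (D := D) (ε := ε) k * Tpow hD hε z m) n ≠ 0) :
    (n : ℝ) < D ^ ε * bprod (D := D) (ε := ε) (η := Core.eta ε) m := by
  obtain ⟨e, t, rfl, hn0, he, ht⟩ := exists_of_mul_apply_ne_zero h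
  have he' := lt_of_PhiK_ne_zero hD hε hε3 he
  have ht' := le_bprod_of_Tpow_ne_zero hD hε z m ht
  have ht0 : (0 : ℝ) < t := by
    have : t ≠ 0 := right_ne_zero_of_mul hn0
    exact_mod_cast Nat.pos_of_ne_zero this
  push_cast
  calc (e : ℝ) * t < D ^ ε * t := mul_lt_mul_of_pos_right he' ht0
    _ ≤ D ^ ε * bprod (D := D) (ε := ε) (η := Core.eta ε) m :=
        mul_le_mul_of_nonneg_left ht' (Real.rpow_nonneg (by linarith) _)

include hD hε in
/-- `HypL1 k` gives `lprod k ≤ D`. [folklore] -/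
theorem lprod_le_of_hypL1 {k : Multiset ℕ} (h : HypL1 (D := D) (ε := ε) (η := Core.eta ε) k) :
    lprod (D := D) (ε := ε) (η := Core.eta ε) k ≤ D := by
  by_cases hk : k = 0
  · subst hk; rw [lprod_zero]; exact hD.le
  · rw [hypL1_iff hk] at h
    have hg : 1 ≤ grid D ε (Core.eta ε) (mmin k) :=
      (one_lt_grid hD hε (by linarith [Core.eta_pos hε]) _).le
    have hl : 0 < lprod (D := D) (ε := ε) (η := Core.eta ε) k := lprod_pos (by linarith) k
    nlinarith [h.2]

end Weights

/-! ### Well-factorability of `Λ̃_k` -/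

section WellFactorable

variable {D ε : ℝ} (hD : 1 < D) (hε : 0 < ε)
include hD hε

/-- `λ_k ≠ 0` forces the hypothesis of Lemma 1 for `k` (upper sieve: no box cut). [folklore] -/
theorem hypL1_of_Lamk_ne_zero {k : Multiset ℕ} (h : Core.Lamk (D := D) (ε := ε) 1 0 k ≠ 0) :
    HypL1 (D := D) (ε := ε) (η := Core.eta ε) k := by
  unfold Core.Lamk at h
  have hc : AdmC (D := D) (ε := ε) (η := Core.eta ε) 1 k ∧ (1 % 2 = 0 → ∀ j ∈ k, j ≤ 0) := by
    by_contra hc; apply h; rw [if_neg hc, mul_zero]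
  exact hypL1_of_admC hD.le (Core.eta_pos hε).le 1 hc.1 (fun h0 => absurd h0 (by norm_num))

/-- Support of `Λ̃_k`-type products under `HypL1 m`: `n < D^ε (lprod m)^{1+η} ≤ D^ε D^{1+η}`. [folklore] -/
theorem lt_of_PhiK_mul_Tpow_ne_zero' (hε3 : ε ≤ 1 / 3) (z : ℝ) (k m : Multiset ℕ) {X : ℝ}
    (hm : lprod (D := D) (ε := ε) (η := Core.eta ε) m ≤ X) {n : ℕ}
    (h : (PhiK (D := D) (ε := ε) k * Tpow hD hε z m) n ≠ 0) :
    (n : ℝ) < D ^ ε * X ^ (1 + Core.eta ε) := by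
  have hD0 : (0 : ℝ) < D := by linarith
  have hη := Core.eta_pos hε
  refine (lt_of_PhiK_mul_Tpow_ne_zero hD hε hε3 z k m h).trans_le ?_
  rw [bprod_eq_lprod_rpow hD0.le]
  exact mul_le_mul_of_nonneg_left (Real.rpow_le_rpow (lprod_pos hD0 _).le hm (by linarith))
    (Real.rpow_nonneg hD0.le _)

/-- **`Λ̃_k` is well factorable of level `D^{1+η+2ε}`** (BFI's notion, `IsWellFactorable`).  For
`Q₁ Q₂ = D^{1+η+2ε}`: if `Q₂ ≤ D^{1+η}`, split `k = k_M + k_N` by Lemma 1 (`splitK_spec`) at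
`N' = Q₂^{1/(1+η)}`, `M' = D/N'` and take `α = (λ_k/c) • Φ_k ⋆ T̃_{k_M}`, `β = T̃_{k_N}`
(`c = binomK`, `T̃_{k_M} ⋆ T̃_{k_N} = c • T̃_k`); if `Q₂ > D^{1+η}` and `Q₁ ≥ D^ε` take `α = λ_k • Φ_k`,
`β = T̃_k`; if `Q₁ < D^ε` take `α = δ₁`, `β = Λ̃_k`.
[cite: BombieriFriedlanderIwaniecActa1986, §1 Definition (well factorable) and §17; IwaniecActaArith1980b, Lemma 1 p. 312] -/
theorem isWellFactorable_wfLam (hε3 : ε ≤ 1 / 3) (z : ℝ) (k : Multiset ℕ) :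
    IsWellFactorable (D ^ (1 + Core.eta ε + 2 * ε)) (fun n => wfLam hD hε z k n) := by
  have hD0 : (0 : ℝ) < D := by linarith
  have hD1 : (1 : ℝ) ≤ D := hD.le
  have hη := Core.eta_pos hε
  set η := Core.eta ε with hηdef
  set A := D ^ ε with hA
  set L := D ^ (1 + η) with hL
  have hA1 : 1 ≤ A := Real.one_le_rpow hD1 hε.le
  have hA0 : 0 < A := by linarith
  have hL0 : 0 < L := Real.rpow_pos_of_pos hD0 _
  have hQ : D ^ (1 + η + 2 * ε) = A * A * L := by
    rw [hA, hL, ← Real.rpow_add hD0, ← Real.rpow_add hD0]; ring_nf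
  set lamk := Core.Lamk (D := D) (ε := ε) 1 0 k with hlamk
  by_cases hlam0 : lamk = 0
  · have h0 : (fun n => wfLam hD hε z k n) = fun _ => 0 := by
      funext n; rw [wfLam, ← hlamk, hlam0, zero_smul, ArithmeticFunction.zero_apply]
    rw [h0]; exact isWellFactorable_zero _
  have hyp : HypL1 (D := D) (ε := ε) (η := η) k := hypL1_of_Lamk_ne_zero hD hε hlam0
  have hlk : lprod (D := D) (ε := ε) (η := η) k ≤ D := lprod_le_of_hypL1 hD hε hyp
  -- support of `Λ̃_k`: `n < A L`
  have hsupp : ∀ n, wfLam hD hε z k n ≠ 0 → (n : ℝ) < A * L := by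
    intro n hn
    rw [wfLam, smul_apply'] at hn
    have h := lt_of_PhiK_mul_Tpow_ne_zero' hD hε hε3 z k k hlk (right_ne_zero_of_mul hn)
    rwa [← hA, ← hL] at h
  refine ⟨abs_wfLam_le_one hD hε z k, (wfLam hD hε z k).map_zero, fun n hn => ?_, fun D₁ D₂ hD₁ hD₂ hDD => ?_⟩
  · by_contra h
    have h1 := hsupp n h
    rw [hQ] at hn
    nlinarith [mul_le_mul_of_nonneg_right hA1 (mul_nonneg hA0.le hL0.le)]
  rw [hQ] at hDD
  by_cases hD₂L : D₂ ≤ L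
  · -- the middle range: Lemma 1
    set Nb := D₂ ^ (1 / (1 + η)) with hNb
    have hNb1 : 1 ≤ Nb := Real.one_le_rpow hD₂ (by positivity)
    have hNb0 : 0 < Nb := by linarith
    have hNbpow : Nb ^ (1 + η) = D₂ := by
      rw [hNb, ← Real.rpow_mul (by linarith), one_div_mul_cancel (by linarith), Real.rpow_one]
    have hNbD : Nb ≤ D := by
      have h1 : Nb ≤ L ^ (1 / (1 + η)) := Real.rpow_le_rpow (by linarith) hD₂L (by positivity)
      rwa [hL, ← Real.rpow_mul hD0.le, mul_one_div_cancel (by linarith), Real.rpow_one] at h1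
    set Mb := D / Nb with hMb
    have hMb1 : 1 ≤ Mb := by rw [hMb, le_div_iff₀ hNb0, one_mul]; exact hNbD
    have hMN : Mb * Nb = D := by rw [hMb]; field_simp
    obtain ⟨hsplit, hM, hN⟩ := splitK_spec (D := D) (ε := ε) (η := η) hD0 hMb1 hNb1 hMN hyp
    set kM := (splitK (D := D) (ε := ε) (η := η) Mb k).1 with hkM
    set kN := (splitK (D := D) (ε := ε) (η := η) Mb k).2 with hkN
    set c : ℝ := (binomK k.toFinset k kM : ℝ) with hc
    have hc1 : 1 ≤ c := by
      rw [hc]; exact_mod_cast one_le_binomK (B := k.toFinset) (by rw [← hsplit]; exact Multiset.le_add_right _ _)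
    have hc0 : c ≠ 0 := by linarith
    refine ⟨(lamk / c) • (PhiK (D := D) (ε := ε) k * Tpow hD hε z kM), Tpow hD hε z kN,
      fun n => ?_, abs_Tpow_le_one hD hε z kN, fun n hn => ?_, fun n hn => ?_, fun n => ?_⟩
    · rw [smul_apply', abs_mul]
      refine mul_le_one₀ ?_ (abs_nonneg _) (abs_PhiK_mul_Tpow_le_one hD hε z k kM n)
      rw [abs_div, div_le_one (by rw [abs_of_pos (by linarith)]; linarith)]
      exact (Core.abs_Lamk_le_one 1 0 k).trans (by rw [abs_of_pos (by linarith)]; exact hc1)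
    · rw [smul_apply']
      by_contra h
      have h1 := lt_of_PhiK_mul_Tpow_ne_zero' hD hε hε3 z k kM hM (right_ne_zero_of_mul h)
      -- `A * Mb^{1+η} = A L / D₂ ≤ D₁`
      have h2 : D ^ ε * Mb ^ (1 + η) ≤ D₁ := by
        have hMbpow : Mb ^ (1 + η) = L / D₂ := by
          rw [hMb, Real.div_rpow hD0.le hNb0.le, hNbpow, hL]
        rw [hMbpow, ← hA, mul_div_assoc', div_le_iff₀ (by linarith)]
        nlinarith [mul_le_mul_of_nonneg_right hA1 (mul_nonneg hA0.le hL0.le)]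
      linarith
    · by_contra h
      have h1 := le_bprod_of_Tpow_ne_zero hD hε z kN h
      rw [bprod_eq_lprod_rpow hD0.le] at h1
      have h2 : lprod (D := D) (ε := ε) (η := η) kN ^ (1 + η) ≤ D₂ := by
        rw [← hNbpow]; exact Real.rpow_le_rpow (lprod_pos hD0 _).le hN (by linarith)
      linarith
    · rw [smul_mul_assoc, mul_assoc, Tpow_mul_Tpow, hsplit, mul_smul_comm, smul_smul, wfLam, ← hlamk, ← hc,
        div_mul_cancel₀ _ hc0]
  · rw [not_le] at hD₂L
    by_cases hD₁A : A ≤ D₁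
    · refine ⟨lamk • PhiK (D := D) (ε := ε) k, Tpow hD hε z k, fun n => ?_, abs_Tpow_le_one hD hε z k,
        fun n hn => ?_, fun n hn => ?_, fun n => ?_⟩
      · rw [smul_apply', abs_mul]
        exact mul_le_one₀ (Core.abs_Lamk_le_one 1 0 k) (abs_nonneg _) (abs_PhiK_le_one (D := D) (ε := ε) k n)
      · rw [smul_apply']
        by_contra h
        have h1 := lt_of_PhiK_ne_zero hD hε hε3 (right_ne_zero_of_mul h)
        rw [← hA] at h1
        linarith
      · by_contra h
        have h1 := le_bprod_of_Tpow_ne_zero hD hε z k h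
        rw [bprod_eq_lprod_rpow hD0.le] at h1
        have h2 : lprod (D := D) (ε := ε) (η := η) k ^ (1 + η) ≤ L :=
          Real.rpow_le_rpow (lprod_pos hD0 _).le hlk (by linarith)
        linarith
      · rw [smul_mul_assoc, wfLam]
    · rw [not_le] at hD₁A
      refine ⟨1, wfLam hD hε z k, fun n => ?_, abs_wfLam_le_one hD hε z k, fun n hn => ?_, fun n hn => ?_,
        fun n => by rw [one_mul]⟩
      · rw [ArithmeticFunction.one_apply]; split_ifs <;> simp
      · rw [ArithmeticFunction.one_apply, if_neg]
        rintro rfl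
        rw [Nat.cast_one] at hn
        linarith
      · by_contra h
        have h1 := hsupp n h
        -- `A L ≤ D₂` since `D₁ < A` and `D₁ D₂ = A² L`
        have h2 : A * L ≤ D₂ := by
          by_contra h2
          rw [not_le] at h2
          have : D₁ * D₂ < A * (A * L) := mul_lt_mul'' hD₁A h2 (by linarith) (by linarith)
          linarith
        linarith

end WellFactorable


section Identity

variable {D ε : ℝ} (hD : 1 < D) (hε : 0 < ε)
include hD hε

/-- The box weight is supported on patterns of the universe (for `z ≤ D`). [cite: IwaniecActaArith1980b, §4 p. 314] -/
theorem pat_mem_Univ_of_lamC_ne_zero {z : ℝ} (hz : z ≤ D) {t : ℕ} (ht : t ∣ primesProdIco (Core.uu D ε) z)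
    (hne : Core.lamC hD hε 1 t ≠ 0) : pat hD hε (Core.eta_pos hε) t ∈ Core.Univ hD hε := by
  have hη := Core.eta_pos hε
  have htsq : Squarefree t := (squarefree_primesProdIco _ _).squarefree_of_dvd ht
  have hpred : BetaSieve.predC 1 (fun t => condK (D := D) (ε := ε) (η := Core.eta ε) (pat hD hε hη t)) t := by
    by_contra h; apply hne; rw [Core.lamC, BetaSieve.indC_of_not_predC h, mul_zero]
  have hprimes : ∀ p ∈ t.primeFactors, Core.uu D ε ≤ (p : ℝ) ∧ (p : ℝ) < z := fun p hp =>
    (dvd_primesProdIco_iff (Nat.prime_of_mem_primeFactors hp) _ z).mp ((Nat.dvd_of_mem_primeFactors hp).trans ht)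
  have htD : (t : ℝ) < D := lt_of_predC_condK hD hε hη 1 htsq hz (fun p hp => (hprimes p hp).2) hpred
  refine pat_mem_patternsLe hD hε hη htsq (fun p hp => ?_) htD (fun p hp => ?_) ?_
  · exact (hprimes p hp).1
  · have : (p : ℝ) ≤ ⌈D⌉₊ := ((hprimes p hp).2.le.trans hz).trans (Nat.le_ceil D)
    exact_mod_cast this
  · rw [Core.Rnat]; push_cast; exact (Nat.lt_floor_add_one _).le

/-- **`∑_{k ∈ 𝒰} Λ̃_k(d) = Λ⁺_z(d)` on the divisors of `P(z)`** (`u ≤ z ≤ D`): the well-factorable weights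
re-assemble the composite upper-sieve weights of `IwaniecBilinearSieveAssembly.lean`.
[cite: IwaniecActaArith1980b, Theorem 1 with (9) p. 309 and (23)–(24) p. 316] -/
theorem sum_wfLam_eq_LamZ {z : ℝ} (hz : z ≤ D) (hzu : Core.uu D ε ≤ z) {d : ℕ} (hd : d ∣ primesProdBelow z) :
    ∑ k ∈ Core.Univ hD hε, wfLam hD hε z k d = Core.LamZ hD hε 1 z d := by
  classical
  have hη := Core.eta_pos hε
  set u := Core.uu D ε with hu
  set Ps := primesProdBelow u with hPs
  set Pr := primesProdIco u z with hPr
  have hPz : primesProdBelow z = Ps * Pr := by rw [hPs, hPr, primesProdBelow_mul_primesProdIco hzu]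
  have hcop : Nat.Coprime Ps Pr := coprime_primesProdBelow_primesProdIco u z
  rw [hPz] at hd
  set e := Nat.gcd d Ps with he
  set t := Nat.gcd d Pr with htdef
  have hde : d = e * t := BetaSieve.eq_gcd_mul_gcd_of_dvd hcop hd
  have hePs : e ∣ Ps := Nat.gcd_dvd_right d Ps
  have htPr : t ∣ Pr := Nat.gcd_dvd_right d Pr
  have hd0 : d ≠ 0 := by
    rintro rfl
    exact (mul_ne_zero (primesProdBelow_ne_zero u) (primesProdIco_ne_zero u z)) (Nat.eq_zero_of_zero_dvd hd)
  -- the right-hand side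
  have hR : Core.LamZ hD hε 1 z d =
      Core.Lamk (D := D) (ε := ε) 1 0 (pat hD hε hη t) * PhiK (D := D) (ε := ε) (pat hD hε hη t) e := by
    rw [Core.LamZ, BetaSieve.compSel_apply, min_eq_right hzu, ← hPs, ← hPr, ← he, ← htdef,
      Core.lamC_eq_Lamk hD hε 1 0 (fun h => absurd h (by norm_num)) htPr, PhiK_apply]
  -- each term of the left-hand side
  have hPs0 : Ps ≠ 0 := primesProdBelow_ne_zero u
  have hL : ∀ k, wfLam hD hε z k d =
      Core.Lamk (D := D) (ε := ε) 1 0 k * (PhiK (D := D) (ε := ε) k e * Tpow hD hε z k t) := by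
    intro k
    rw [wfLam, smul_apply']
    congr 1
    refine mul_apply_eq_of_forall_eq (by rw [hde]) hd0 fun x y hxy hx hy => ?_
    -- `x = e`: `x ∣ P(u)` and `y` has all its primes `≥ u`
    have hxPs : x ∣ Ps := dvd_of_PhiK_ne_zero (D := D) (ε := ε) hx
    have hy0 : y ≠ 0 := fun h => hd0 (by rw [← hxy, h, mul_zero])
    have hycop : Nat.Coprime Ps y := by
      rw [← Nat.disjoint_primeFactors hPs0 hy0, Finset.disjoint_left]
      intro p hpP hpy
      have hpu : (p : ℝ) < u := by
        rw [hPs, primeFactors_primesProdBelow, Nat.mem_primesBelow] at hpP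
        exact Nat.lt_ceil.mp hpP.1
      exact absurd hpu (not_lt.mpr (prime_range_of_Tpow_ne_zero hD hε z k hy hpy).1)
    have h1 : x ∣ e := Nat.dvd_gcd (Dvd.intro y hxy) hxPs
    have h2 : e ∣ x := (Nat.Coprime.coprime_dvd_left hePs hycop).dvd_of_dvd_mul_right (by rw [hxy, hde]; exact dvd_mul_right e t)
    exact Nat.dvd_antisymm h1 h2
  -- sum over the universe
  rw [Finset.sum_congr rfl fun k _ => hL k]
  simp_rw [Tpow_apply_of_dvd hD hε z _ htPr, mul_ite, mul_one, mul_zero]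
  rw [Finset.sum_ite_eq, hR]
  by_cases hmem : pat hD hε hη t ∈ Core.Univ hD hε
  · rw [if_pos hmem]
  · rw [if_neg hmem]
    have h0 : Core.lamC hD hε 1 t = 0 := by
      by_contra h; exact hmem (pat_mem_Univ_of_lamC_ne_zero hD hε hz htPr h)
    rw [Core.lamC_eq_Lamk hD hε 1 0 (fun h => absurd h (by norm_num)) htPr] at h0
    rw [h0, zero_mul]

/-- **Off the divisors of `P(z)`, `Λ̃_k` lives on numbers with a repeated prime of `[u, z)`**: if
`Λ̃_k(q) ≠ 0` and `q ∤ P(z)` then `p² ∣ q` for some prime `u ≤ p < z` (`u ≤ z`). [folklore] -/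
theorem exists_sq_dvd_of_wfLam_ne_zero {z : ℝ} (hzu : Core.uu D ε ≤ z) {k : Multiset ℕ} {q : ℕ}
    (hq : wfLam hD hε z k q ≠ 0) (hnd : ¬ q ∣ primesProdBelow z) :
    ∃ p : ℕ, p.Prime ∧ Core.uu D ε ≤ (p : ℝ) ∧ (p : ℝ) < z ∧ p ^ 2 ∣ q := by
  rw [wfLam, smul_apply'] at hq
  obtain ⟨e, t, rfl, hq0, he, ht⟩ := exists_of_mul_apply_ne_zero (right_ne_zero_of_mul hq)
  have heu : e ∣ primesProdBelow (Core.uu D ε) := dvd_of_PhiK_ne_zero (D := D) (ε := ε) he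
  have hrange := fun p hp => prime_range_of_Tpow_ne_zero hD hε z k ht (p := p) hp
  have ht0 : t ≠ 0 := right_ne_zero_of_mul hq0
  -- `t` is not squarefree
  have htnsq : ¬ Squarefree t := by
    intro htsq
    apply hnd
    have htPr : t ∣ primesProdIco (Core.uu D ε) z := by
      rw [← Nat.prod_primeFactors_of_squarefree htsq,
        ← Nat.prod_primeFactors_of_squarefree (squarefree_primesProdIco (Core.uu D ε) z)]
      refine Finset.prod_dvd_prod_of_subset _ _ _ fun p hp => ?_
      rw [primeFactors_primesProdIco, Finset.mem_filter, Nat.mem_primesBelow, Nat.lt_ceil]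
      exact ⟨⟨(hrange p hp).2, Nat.prime_of_mem_primeFactors hp⟩, (hrange p hp).1⟩
    rw [← primesProdBelow_mul_primesProdIco hzu]
    exact mul_dvd_mul heu htPr
  rw [Nat.squarefree_iff_prime_squarefree] at htnsq
  push Not at htnsq
  obtain ⟨p, hp, hpt⟩ := htnsq
  have hpmem : p ∈ t.primeFactors := Nat.mem_primeFactors.mpr ⟨hp, (dvd_mul_right p p).trans hpt, ht0⟩
  refine ⟨p, hp, (hrange p hpmem).1, (hrange p hpmem).2, ?_⟩
  rw [sq]
  exact hpt.trans (dvd_mul_left t e)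

/-- `Λ̃_k(q) ≠ 0` forces `q ≤ D^{1+η+2ε}`. [folklore] -/
theorem le_of_wfLam_ne_zero (hε3 : ε ≤ 1 / 3) (z : ℝ) (k : Multiset ℕ) {q : ℕ} (hq : wfLam hD hε z k q ≠ 0) :
    (q : ℝ) ≤ D ^ (1 + Core.eta ε + 2 * ε) := by
  by_contra h
  exact hq ((isWellFactorable_wfLam hD hε hε3 z k).eq_zero_of_lt (not_le.mp h))

end Identity

/-! ### The remainder in well-factorable form -/

section Remainder

/-- The level `Q = D^{1+η+2ε}` of the well-factorable weights. [folklore] -/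
def levelQ (D ε : ℝ) : ℝ := D ^ (1 + Core.eta ε + 2 * ε)

open Classical in
/-- The junk moduli: `1 ≤ q ≤ Q` divisible by `p²` for a prime `u ≤ p < z`. [folklore] -/
def junkSet (D ε z : ℝ) : Finset ℕ :=
  (Finset.Icc 1 ⌊levelQ D ε⌋₊).filter (fun q => ∃ p : ℕ, p.Prime ∧ Core.uu D ε ≤ (p : ℝ) ∧ (p : ℝ) < z ∧ p ^ 2 ∣ q)

variable {D ε : ℝ} (hD : 1 < D) (hε : 0 < ε)
include hD hε

/-- **The remainder of `Λ⁺_z` in well-factorable form**: for every `r` and `u ≤ z ≤ D`,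
`∑_{d ∣ P(z)} Λ⁺_z(d) r(d) = ∑_{k ∈ 𝒰} ∑_{1 ≤ q ≤ Q} Λ̃_k(q) r(q) − ∑_{k ∈ 𝒰} ∑_{1 ≤ q ≤ Q, q ∤ P(z)} Λ̃_k(q) r(q)`.
[cite: IwaniecActaArith1980b, Theorem 1 (remainder term)] -/
theorem sum_LamZ_mul_eq (hε3 : ε ≤ 1 / 3) {z : ℝ} (hz : z ≤ D) (hzu : Core.uu D ε ≤ z) (r : ℕ → ℝ) :
    ∑ d ∈ (primesProdBelow z).divisors, Core.LamZ hD hε 1 z d * r d =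
      (∑ k ∈ Core.Univ hD hε, ∑ q ∈ Finset.Icc 1 ⌊levelQ D ε⌋₊, wfLam hD hε z k q * r q) -
        ∑ k ∈ Core.Univ hD hε, ∑ q ∈ (Finset.Icc 1 ⌊levelQ D ε⌋₊).filter (fun q => ¬ q ∣ primesProdBelow z),
          wfLam hD hε z k q * r q := by
  classical
  set P := primesProdBelow z with hP
  set N := ⌊levelQ D ε⌋₊ with hN
  have hP0 : P ≠ 0 := primesProdBelow_ne_zero z
  -- split the full sum into `q ∣ P` and `q ∤ P`
  have hsplit : ∀ k, ∑ q ∈ Finset.Icc 1 N, wfLam hD hε z k q * r q =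
      (∑ q ∈ (Finset.Icc 1 N).filter (· ∣ P), wfLam hD hε z k q * r q) +
        ∑ q ∈ (Finset.Icc 1 N).filter (fun q => ¬ q ∣ P), wfLam hD hε z k q * r q := fun k =>
    (Finset.sum_filter_add_sum_filter_not _ _ _).symm
  rw [Finset.sum_congr rfl fun k _ => hsplit k, Finset.sum_add_distrib, add_sub_cancel_right]
  -- the divisor part: `∑_{d ∣ P} Λ_z(d) r(d) = ∑_k ∑_{q ≤ N, q ∣ P} Λ̃_k(q) r(q)`
  have hsub : (Finset.Icc 1 N).filter (· ∣ P) ⊆ P.divisors := by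
    intro q hq
    rw [Finset.mem_filter] at hq
    exact Nat.mem_divisors.mpr ⟨hq.2, hP0⟩
  have hvan : ∀ k, ∀ d ∈ P.divisors, d ∉ (Finset.Icc 1 N).filter (· ∣ P) → wfLam hD hε z k d * r d = 0 := by
    intro k d hd hnot
    have hdP := Nat.dvd_of_mem_divisors hd
    have hd1 : 1 ≤ d := Nat.pos_of_dvd_of_pos hdP (Nat.pos_of_ne_zero hP0)
    by_cases hw : wfLam hD hε z k d = 0
    · rw [hw, zero_mul]
    · exfalso
      apply hnot
      rw [Finset.mem_filter, Finset.mem_Icc]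
      exact ⟨⟨hd1, Nat.le_floor (le_of_wfLam_ne_zero hD hε hε3 z k hw)⟩, hdP⟩
  calc ∑ d ∈ P.divisors, Core.LamZ hD hε 1 z d * r d
      = ∑ d ∈ P.divisors, ∑ k ∈ Core.Univ hD hε, wfLam hD hε z k d * r d := by
        refine Finset.sum_congr rfl fun d hd => ?_
        rw [← Finset.sum_mul, sum_wfLam_eq_LamZ hD hε hz hzu (Nat.dvd_of_mem_divisors hd)]
    _ = ∑ k ∈ Core.Univ hD hε, ∑ d ∈ P.divisors, wfLam hD hε z k d * r d := Finset.sum_comm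
    _ = ∑ k ∈ Core.Univ hD hε, ∑ q ∈ (Finset.Icc 1 N).filter (· ∣ P), wfLam hD hε z k q * r q :=
        Finset.sum_congr rfl fun k _ => (Finset.sum_subset hsub (hvan k)).symm

/-- **The junk part is small in `L¹`**: `|∑_{k ∈ 𝒰} ∑_{q ≤ Q, q ∤ P(z)} Λ̃_k(q) r(q)| ≤ #𝒰 · ∑_{q ∈ junk} |r(q)|`.
[folklore] -/
theorem abs_junk_le {z : ℝ} (hzu : Core.uu D ε ≤ z) (r : ℕ → ℝ) :
    |∑ k ∈ Core.Univ hD hε, ∑ q ∈ (Finset.Icc 1 ⌊levelQ D ε⌋₊).filter (fun q => ¬ q ∣ primesProdBelow z),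
        wfLam hD hε z k q * r q| ≤
      (Core.Univ hD hε).card * ∑ q ∈ junkSet D ε z, |r q| := by
  classical
  refine (Finset.abs_sum_le_sum_abs _ _).trans ?_
  have hk : ∀ k ∈ Core.Univ hD hε,
      |∑ q ∈ (Finset.Icc 1 ⌊levelQ D ε⌋₊).filter (fun q => ¬ q ∣ primesProdBelow z), wfLam hD hε z k q * r q| ≤
        ∑ q ∈ junkSet D ε z, |r q| := by
    intro k _
    refine (Finset.abs_sum_le_sum_abs _ _).trans ?_
    -- termwise: nonzero terms lie in the junk set and are bounded by `|r q|`
    calc ∑ q ∈ (Finset.Icc 1 ⌊levelQ D ε⌋₊).filter (fun q => ¬ q ∣ primesProdBelow z), |wfLam hD hε z k q * r q|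
        = ∑ q ∈ (Finset.Icc 1 ⌊levelQ D ε⌋₊).filter (fun q => ¬ q ∣ primesProdBelow z),
            (if q ∈ junkSet D ε z then |wfLam hD hε z k q * r q| else 0) := by
          refine Finset.sum_congr rfl fun q hq => ?_
          by_cases hj : q ∈ junkSet D ε z
          · rw [if_pos hj]
          · rw [if_neg hj]
            rw [Finset.mem_filter] at hq
            by_cases hw : wfLam hD hε z k q = 0
            · rw [hw, zero_mul, abs_zero]
            · exfalso; apply hj
              rw [junkSet, Finset.mem_filter]
              exact ⟨hq.1, exists_sq_dvd_of_wfLam_ne_zero hD hε hzu hw hq.2⟩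
      _ = ∑ q ∈ ((Finset.Icc 1 ⌊levelQ D ε⌋₊).filter (fun q => ¬ q ∣ primesProdBelow z)).filter
            (· ∈ junkSet D ε z), |wfLam hD hε z k q * r q| := (Finset.sum_filter _ _).symm
      _ ≤ ∑ q ∈ junkSet D ε z, |wfLam hD hε z k q * r q| := by
          refine Finset.sum_le_sum_of_subset_of_nonneg (fun q hq => (Finset.mem_filter.mp hq).2)
            fun q _ _ => abs_nonneg _
      _ ≤ ∑ q ∈ junkSet D ε z, |r q| := by
          refine Finset.sum_le_sum fun q _ => ?_
          rw [abs_mul]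
          exact mul_le_of_le_one_left (abs_nonneg _) (abs_wfLam_le_one hD hε z k q)
  calc ∑ k ∈ Core.Univ hD hε,
        |∑ q ∈ (Finset.Icc 1 ⌊levelQ D ε⌋₊).filter (fun q => ¬ q ∣ primesProdBelow z), wfLam hD hε z k q * r q|
      ≤ ∑ _k ∈ Core.Univ hD hε, ∑ q ∈ junkSet D ε z, |r q| := Finset.sum_le_sum hk
    _ = (Core.Univ hD hε).card * ∑ q ∈ junkSet D ε z, |r q| := by
        rw [Finset.sum_const, nsmul_eq_mul]

end Remainder

/-! ### The linear sieve upper bound with well-factorable remainder -/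

section Sieve

variable {D ε : ℝ} (hD : 1 < D) (hε : 0 < ε)
include hD hε

/-- The upper-sieve inequality for a sifted sequence with the weights `Λ⁺_z`:
`S(A, z) ≤ ∑_{d ∣ P(z)} Λ⁺_z(d) A_d`. [cite: IwaniecActaArith1980b, §4 (15)–(16)] -/
theorem sifted_le_sum_LamZ (A : SieveSequence) (X z : ℝ) :
    A.sifted X (primesProdBelow z) ≤
      ∑ d ∈ (primesProdBelow z).divisors, Core.LamZ hD hε 1 z d * A.congrSum d X := by
  rw [A.sum_weights_congrSum _ (primesProdBelow_ne_zero z), A.sifted_eq_sum_ite]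
  refine Finset.sum_le_sum fun n _ => mul_le_mul_of_nonneg_left ?_ (A.a_nonneg n)
  exact (Core.upper_lower_LamZ hD hε z (Nat.gcd_dvd_right n (primesProdBelow z))).1

/-- Splitting `A_d = g(d) X + r(d)` in the weighted sum. [folklore] -/
theorem sum_LamZ_congrSum_eq (A : SieveSequence) (X z : ℝ) :
    ∑ d ∈ (primesProdBelow z).divisors, Core.LamZ hD hε 1 z d * A.congrSum d X =
      A.size X * ∑ d ∈ (primesProdBelow z).divisors, Core.LamZ hD hε 1 z d * A.density d +
        ∑ d ∈ (primesProdBelow z).divisors, Core.LamZ hD hε 1 z d * A.remainder d X := by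
  rw [Finset.mul_sum, ← Finset.sum_add_distrib]
  refine Finset.sum_congr rfl fun d _ => ?_
  rw [SieveSequence.remainder]; ring

/-- **Iwaniec's linear sieve, upper bound, with WELL-FACTORABLE remainder** (the form consumed by
Bombieri–Friedlander–Iwaniec, Acta Math. 156 (1986), §1 Corollary 2 and §17 p. 251: "the linear sieve result
of [15]" with Theorem 10).  Let `A` be a sifted sequence whose density `g` satisfies `Ω(1, K)`
(`HasIwaniecDimension g 1 K`, i.e. Iwaniec's condition (1) p. 308 with `0 ≤ g(p) < 1`), `K ≥ 1`, `0 < ε ≤ 1/3`,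
and let `D` lie in the main regime (`200K ≤ ε² log D`, `200K ≤ √log D`, `30 ≤ ε √log D`,
`ε⁻⁴ < log D ∨ ε ≤ 1/30`).  Then for `max(2, u) ≤ z ≤ D` (`u = D^{ε²}`) and every height `X` with `A.size X ≥ 0`,
`S(A, z) ≤ X V(z) (F(log D/log z) + 5·10²⁴(1+C_d)²(ε + ε⁻⁸ eᴷ/log D))
  + ∑_{k ∈ 𝒰} ∑_{1 ≤ q ≤ Q} Λ̃_k(q) r(A, q) + #𝒰 · ∑_{q ∈ junk} |r(A, q)|`,
where `Q = D^{1+η+2ε}` (`levelQ`), each `Λ̃_k = WF.wfLam … z k` is well factorable of level `Q`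
(`WF.isWellFactorable_wfLam`) with `|Λ̃_k| ≤ 1`, `#𝒰 ≤ L₁(ε)` (`Core.card_Univ_le`), `junk = junkSet D ε z`
(moduli `q ≤ Q` with `p² ∣ q` for a prime `u ≤ p < z`), `F = F₁` the upper linear-sieve function and `C_d` its
decay constant (`exists_linearSieve_decay`).
[cite: IwaniecActaArith1980b, Theorem 1; BombieriFriedlanderIwaniecActa1986, §1 Corollary 2 (use of [15])] -/
theorem sifted_le_wellFactorable (hε3 : ε ≤ 1 / 3) (A : SieveSequence) {K : ℝ} (hK1 : 1 ≤ K)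
    (hdim : HasIwaniecDimension A.density 1 K)
    (hKu : 200 * K ≤ ε ^ 2 * Real.log D) (hKw : 200 * K ≤ Real.sqrt (Real.log D))
    (h30 : 30 ≤ ε * Real.sqrt (Real.log D)) (hsplit : ε⁻¹ ^ 4 < Real.log D ∨ ε ≤ 1 / 30) {Cd : ℝ} (hCd : 0 ≤ Cd)
    (hCdF : ∀ s : ℝ, 1 ≤ s → |upperSieveFun 1 s - 1| ≤ Cd * Real.exp (-s))
    (hCdf : ∀ s : ℝ, 2 ≤ s → |lowerSieveFun 1 s - 1| ≤ Cd * Real.exp (-s))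
    {z : ℝ} (hz2 : 2 ≤ z) (hzD : z ≤ D) (hzu : Core.uu D ε ≤ z) (X : ℝ) (hX : 0 ≤ A.size X) :
    A.sifted X (primesProdBelow z) ≤
      A.size X * A.densityProduct (primesProdBelow z) *
          (upperSieveFun 1 (Real.log D / Real.log z) +
            5e24 * (1 + Cd) ^ 2 * (ε + ε⁻¹ ^ 8 * Real.exp K / Real.log D)) +
        (∑ k ∈ Core.Univ hD hε, ∑ q ∈ Finset.Icc 1 ⌊levelQ D ε⌋₊, wfLam hD hε z k q * A.remainder q X) +
        (Core.Univ hD hε).card * ∑ q ∈ junkSet D ε z, |A.remainder q X| := by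
  -- condition (1) and `0 ≤ g(p) < 1` from `Ω(1, K)`
  have h01 : ∀ p : ℕ, p.Prime → 0 ≤ A.density p ∧ A.density p < 1 := hdim.1
  have h1 : ∀ w y : ℝ, 2 ≤ w → w < y →
      ∏ p ∈ (Nat.primesBelow ⌈y⌉₊).filter (fun p : ℕ => w ≤ (p : ℝ)), (1 - A.density p)⁻¹ ≤
        Real.log y / Real.log w * (1 + K / Real.log w) := by
    intro w y hw hwy
    have h := hdim.2 w y hw hwy.le
    rwa [Real.rpow_one] at h
  have hmain := (Core.main_regime_bounds hD hε A.density_mult hK1 h1 h01 hε3 hKu hKw h30 hsplit hCd hCdF hCdf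
    hz2 hzD).1
  have hV : BetaSieve.vprod A.density (primesProdBelow z) = A.densityProduct (primesProdBelow z) := rfl
  rw [hV] at hmain
  have hrem := sum_LamZ_mul_eq hD hε hε3 hzD hzu (fun q => A.remainder q X)
  have hjunk := abs_junk_le hD hε hzu (fun q => A.remainder q X)
  have hstep1 := sifted_le_sum_LamZ hD hε A X z
  rw [sum_LamZ_congrSum_eq hD hε A X z, hrem] at hstep1
  have hneg := neg_abs_le (∑ k ∈ Core.Univ hD hε, ∑ q ∈ (Finset.Icc 1 ⌊levelQ D ε⌋₊).filter
      (fun q => ¬ q ∣ primesProdBelow z), wfLam hD hε z k q * A.remainder q X)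
  nlinarith [mul_le_mul_of_nonneg_left hmain hX]

end Sieve

end WF

end Iwaniec1980b

end Literature.NumberTheory.Sieve

end
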